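import Literature.Topology.FourManifolds.ThickenedPlanarHandlebody
import Literature.Topology.FourManifolds.MorseChartChange
import Literature.Topology.FourManifolds.MorseExtrema
import Mathlib.Analysis.InnerProductSpace.Calculus
import Mathlib.Analysis.Complex.Isometry
import Mathlib.Analysis.SpecialFunctions.Complex.Circle
import Mathlib.RingTheory.RootsOfUnity.Complex
import Mathlib.Analysis.SpecialFunctions.Pow.Real
import Mathlib.Analysis.Calculus.Deriv.MeanValue
import Mathlib.Analysis.Complex.ExponentialBounds
import HarnessLib

/-!
# The flower: an explicit planar Morse function presenting a disc with `g` holes, and the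
# explicit genus-`g` handlebody `{q_g(x, y) + z² ≤ c_g} ⊂ ℝ³` for every `g ≥ 2`

Topic `Literature/Topology/FourManifolds`; fact seat
`provefact-Literature.Topology.FourManifolds.exists-cbed50d78a` (named fact (g′)
`Literature.Topology.FourManifolds.exists_marking_centralSurface_of_gkTrisection`, Gay–Kirby (2016),
Def. 1 / Remark 2: *the central surface `F = X₁ ∩ X₂ ∩ X₃ = ∂H_{ij}` of a `(g, k)`-trisection is a
closed surface of genus `g`*, in the tree's form `S_g ≃* π₁(F, x₀)`).  That fact is reduced
(`TrisectionCentralSurfaceMarking.lean`, `exists_marking_centralSurface_of_gkTrisection_of_model`)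
to the `1`-handle lemma L1 and ONE genus-`g` model handlebody whose boundary is marked by the
surface group `S_g`.  For `g ≥ 2` such a model needs an EXPLICIT boundary surface on which
`π₁ = S_g` can be computed (Hatcher, *Algebraic Topology*, §1.2, p. 51); the genus-`g`
handlebodies already in the tree for `g ≥ 2` (`PlanarMorseHandlebodies.lean`: Milnor's birth
insertion, `exists_isHandlebody`) have no explicit boundary.  This file supplies the explicit model.
Everything here is **proved**; no named facts are introduced.

## The flower

On `ℝ² = ℂ` let, for `g ≥ 2`,

  `q_g(z) = |z|² + g⁻¹ · Re(z^g) · exp(-|z|^{20g} / 20)`          (`FlowerModel.flower`)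

(`Re(z^g) = r^g cos(gθ)`: a paraboloid with `g` symmetric petals, damped steeply beyond the unit
circle).  We prove (`FlowerModel.isHoledDiscMorseFunction_flower`) that `q_g` is a planar Morse
function presenting a disc with `g` holes below an explicit level `c_g`
(`Literature.Topology.FourManifolds.IsHoledDiscMorseFunction g (flower g) (level g)`,
`ThickenedPlanarHandlebody.lean`): it is smooth and coercive (`‖p‖² ≤ q + 20`), and its critical
points are exactly

* the origin, a nondegenerate minimum (index `0`, value `0 < c_g`);
* the `g` **passes** `r_b ζ_j` (`ζ_j = e^{2πij/g}`), nondegenerate of index `1`, value `< c_g`;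
* the `g` **peaks** `r_a ζ_j`, nondegenerate of index `2`, value `> c_g`,

where `1 < r_a < 7^{1/20g} < 22^{1/20g} < r_b < 400^{1/20g}` are the two positive zeros of the
derivative `f'(r) = 2r + r^{g-1} E(r²)(1 - r^{20g})` of the peak-ray profile
`f(r) = q_g(r) = r² + g⁻¹ r^g E(r²)`, `E(s) = exp(-s^{10g}/20)`, and `c_g = f(7^{1/20g})`.
Consequently (`ThickenedPlanarHandlebody.lean`, `IsHoledDiscMorseFunction.isHandlebody_thickening`)

* `FlowerModel.FlowerHandlebody hg = {q_g(x, y) + z² ≤ c_g}` **is a genus-`g` handlebody**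
  (`FlowerModel.isHandlebody_flowerHandlebody : IsHandlebody g (FlowerHandlebody hg)`), and
* **its boundary is the explicit flower surface** `{q_g(x, y) + z² = c_g} ⊂ ℝ³`
  (`FlowerModel.boundaryHomeomorph : ∂V_g ≃ₜ {q_g + z² = c_g}`), the double of the disc with `g`
  holes `{q_g ≤ c_g}` — in polar coordinates the necklace `{cos(gθ) ≤ (c_g - r²) g e^{r^{20g}/20} / r^g}`
  —, invariant under `z ↦ -z` and under the rotations by `ζ_j` (`FlowerModel.flower_rot`).

The computation of `π₁` of this surface (the marking by `S_g`) is the sequel.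

## Proof

* §2–§3: `dq_p(v) = 2(1 + g⁻¹ P E'(s))⟨p, v⟩ + g⁻¹ E(s) Re(g z^{g-1} v)` (`P = Re z^g`, `s = |z|²`,
  `FlowerModel.hasFDerivAt_flower`); in the radial and angular directions
  `dq_p(p) = 2s(1 + g⁻¹ P E') + E P` and `dq_p(ip) = -E · Im z^g`.
* §4: at a critical point `z ≠ 0`: `Im z^g = 0`, so `z^g = ±r^g`; the sign `-` (valley rays) is
  excluded since there the radial residual is `r (2r - r^{g-1}E(1 - r^{20g})) > 0`; hence
  `z = r ζ_j` with `f'(r) = 0` (roots of unity: `IsPrimitiveRoot.eq_pow_of_pow_eq_one`).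
* §5 (one real variable): `f'(r) = r (2 - φ(r))`, `φ(r) = r^{g-2}(r^{20g} - 1)E(r²)`,
  `r φ'(r) = r^{g-2} E(r²) β(r^{20g})` with `β(u) = (g-2)(u-1) + g u (21-u)`, positive on `[1, 20]`,
  negative on `[22, ∞)`; `φ(1) = 0`, `φ(7^{1/20g}) ≥ 6 e^{-7/20} > 2`, `φ > 2` on
  `20 ≤ r^{20g} ≤ 22`, `φ(400^{1/20g}) ≤ 400 · 399 · e^{-20} < 2` (`Real.exp_one_gt_d9`); so
  `φ = 2` has exactly the two positive roots `r_a`, `r_b` (intermediate values and strict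
  monotonicity), `f''(r_a) = -r_a φ'(r_a) < 0 < f''(r_b)`, and `f` decreases strictly on
  `[r_a, r_b] ∋ 7^{1/20g}`.
* §6: the Hessian at `(r, 0)` is `diag(f''(r), 2 + 2g⁻¹ r^g E'(r²) - (g-1) r^{g-2} E(r²))`, the
  second entry being `-g r^{g-2} E(r²) < 0` at the roots (entries computed as derivatives of
  `t ↦ dq_{p + tv}(w)` along lines, `FlowerModel.hasDerivAt_fderiv_line`); indices by Sylvester
  (`QuadraticForm.sigNeg_of_equiv_weightedSumSquares`); at the origin `q ≥ ‖·‖²/2`, so the Hessian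
  dominates the identity (`IsLocalMin.fderiv_fderiv_apply_self_nonneg` applied to `q - ‖·‖²/2`).
* §7: `q ∘ R = q` for the rotations `R` by `ζ_j` (`Complex.orthonormalBasisOneI`, `rotation`), and
  criticality, nondegeneracy and index are invariant under a linear automorphism preserving `q`
  (`ContinuousLinearMap.iteratedFDeriv_comp_right`, congruence lemmas of `MorseChartChange.lean`).
* §8–§9: assembly; the handlebody and its boundary as in `RoundSolidTorus.lean`.

## References

* D. Gay, R. Kirby, *Trisecting 4-manifolds*, Geom. Topol. 20 (2016), Def. 1 and Remark 2
  (p. 3098: the central genus-`g` surface `F_g = ∂H_{ij}`). [GayKirby2016]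
* A. Juhász, *Differential and Low-Dimensional Topology*, LMS Student Texts 104 (2023), §3.5,
  pp. 96–97 (genus-`g` handlebodies as thickened planar domains in `ℝ³`). [Juhasz2023]
* J. Schultens, *Introduction to 3-Manifolds*, GSM 151 (2014), Def. 6.1.5. [Schultens2014]
* J. Milnor, *Morse theory*, Ann. of Math. Studies 51 (1963), §2 (nondegeneracy, index),
  §3 (Thms. 3.1–3.2). [Milnor1963]
* A. Hatcher, *Algebraic Topology* (2002), §1.2, p. 51 (`π₁(Σ_g)`, the sequel). [HatcherAT2002]
-/

open scoped Manifold ContDiff Topology InnerProductSpace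
open Set Function Filter Metric Module Complex

noncomputable section

namespace Literature.Topology.FourManifolds

/-- Local notation: `𝔼 n` is the model Euclidean space `EuclideanSpace ℝ (Fin n)`. -/
local notation "𝔼 " n:arg => EuclideanSpace ℝ (Fin n)

namespace FlowerModel

/-! ### §1 The plane as `ℂ`; rotations -/

/-- The linear isometry `ℝ² ≃ ℂ`, `p ↦ p₀ + p₁ i` (inverse of Mathlib's
`Complex.orthonormalBasisOneI.repr`).  It has the same values as the plain function
`Literature.Topology.FourManifolds.toC` of `TorusCoordinates.lean`
(`toC_eq_orthonormalBasisOneI_repr_symm` there), which is not imported here: we use the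
isometry-equivalence structure (norms, inner products, `map_add`/`map_smul`, injectivity) throughout,
and that file's imports (spheres, knots, circle surgery) are foreign to this one. [folklore] -/
def toC : 𝔼 2 ≃ₗᵢ[ℝ] ℂ := Complex.orthonormalBasisOneI.repr.symm

/-- `toC p = p₀ + p₁ i`. [folklore] -/
@[simp] theorem toC_apply (p : 𝔼 2) : toC p = p 0 + p 1 * I :=
  Complex.orthonormalBasisOneI_repr_symm_apply p

/-- `toC` preserves norms. [folklore] -/
@[simp] theorem norm_toC (p : 𝔼 2) : ‖toC p‖ = ‖p‖ := toC.norm_map p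

/-- Real part of `toC⁻¹`. [folklore] -/
@[simp] theorem toC_symm_apply_zero (z : ℂ) : toC.symm z 0 = z.re := by
  simp [toC, Complex.orthonormalBasisOneI_repr_apply]

/-- Imaginary part of `toC⁻¹`. [folklore] -/
@[simp] theorem toC_symm_apply_one (z : ℂ) : toC.symm z 1 = z.im := by
  simp [toC, Complex.orthonormalBasisOneI_repr_apply]

/-- `toC` as a continuous linear map. [folklore] -/
def toCL : 𝔼 2 →L[ℝ] ℂ := (toC.toContinuousLinearEquiv : 𝔼 2 ≃L[ℝ] ℂ)

/-- `toCL` is `toC`. [folklore] -/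
@[simp] theorem toCL_apply (p : 𝔼 2) : toCL p = toC p := rfl

/-- The rotation of the plane by the unit complex number `a`. [folklore] -/
def rot (a : Circle) : 𝔼 2 ≃ₗᵢ[ℝ] 𝔼 2 := (toC.trans (rotation a)).trans toC.symm

/-- `toC (rot a p) = a · toC p`. [folklore] -/
@[simp] theorem toC_rot (a : Circle) (p : 𝔼 2) : toC (rot a p) = a * toC p := by
  simp [rot, rotation_apply]

/-- Rotations preserve the norm. [folklore] -/
@[simp] theorem norm_rot (a : Circle) (p : 𝔼 2) : ‖rot a p‖ = ‖p‖ := (rot a).norm_map p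


/-! ### §2 The flower function and its first derivative -/

variable (g : ℕ)

/-- The radial damping factor `E(s) = exp(-s^{10g}/20)`, as a function of `s = ‖p‖²`. [folklore] -/
def damp (s : ℝ) : ℝ := Real.exp (-(s ^ (10 * g) / 20))

/-- `dE/ds = -(g/2) s^{10g-1} E(s)`. [folklore] -/
def dampD (s : ℝ) : ℝ := -((g : ℝ) / 2) * s ^ (10 * g - 1) * damp g s

/-- The angular harmonic `P(p) = Re (p₀ + p₁ i)^g = r^g cos(gθ)`. [folklore] -/
def harm (p : 𝔼 2) : ℝ := ((toC p) ^ g).re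

/-- The derivative of `P`: `dP_p(v) = Re (g (toC p)^{g-1} toC v)`. [folklore] -/
def harmD (p : 𝔼 2) : 𝔼 2 →L[ℝ] ℝ := reCLM.comp (((g : ℂ) * toC p ^ (g - 1)) • toCL)

/-- **The flower function** `q(p) = ‖p‖² + g⁻¹ · Re (toC p)^g · exp(-‖p‖^{20g}/20)`. [folklore] -/
def flower (p : 𝔼 2) : ℝ := ‖p‖ ^ 2 + (g : ℝ)⁻¹ * harm g p * damp g (‖p‖ ^ 2)

/-- The derivative of the flower function. [folklore] -/
def flowerD (p : 𝔼 2) : 𝔼 2 →L[ℝ] ℝ :=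
  (2 * (1 + (g : ℝ)⁻¹ * harm g p * dampD g (‖p‖ ^ 2))) • (innerSL ℝ p : 𝔼 2 →L[ℝ] ℝ) +
    ((g : ℝ)⁻¹ * damp g (‖p‖ ^ 2)) • harmD g p

variable {g}

/-- `E > 0`. [folklore] -/
theorem damp_pos (s : ℝ) : 0 < damp g s := Real.exp_pos _

/-- `E ≤ 1` on `s ≥ 0`. [folklore] -/
theorem damp_le_one {s : ℝ} (hs : 0 ≤ s) : damp g s ≤ 1 := by
  rw [damp, Real.exp_le_one_iff, neg_nonpos]
  positivity

/-- `E(0) = 1` (for `g ≥ 1`). [folklore] -/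
theorem damp_zero (hg : 1 ≤ g) : damp g 0 = 1 := by
  have : 10 * g ≠ 0 := by omega
  simp [damp, zero_pow this]

/-- The derivative of `E`. [folklore] -/
theorem hasDerivAt_damp (s : ℝ) : HasDerivAt (damp g) (dampD g s) s := by
  have h : HasDerivAt (fun x : ℝ => -(x ^ (10 * g) / 20))
      (-(((10 * g : ℕ) : ℝ) * s ^ (10 * g - 1) / 20)) s :=
    ((hasDerivAt_pow (10 * g) s).div_const 20).neg
  refine (h.exp).congr_deriv ?_
  rw [dampD, damp]
  push_cast
  ring

/-- `E` is smooth. [folklore] -/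
theorem contDiff_damp : ContDiff ℝ ∞ (damp g) := by
  unfold damp
  fun_prop

/-- The derivative of `P`. [folklore] -/
theorem hasFDerivAt_harm (p : 𝔼 2) : HasFDerivAt (harm g) (harmD g p) p := by
  have h1 : HasFDerivAt (fun p : 𝔼 2 => toCL p) toCL p := toCL.hasFDerivAt
  have h2 : HasFDerivAt (fun x : 𝔼 2 => toCL x ^ g) (((g : ℂ) * toCL p ^ (g - 1)) • toCL) p := by
    have := h1.pow g
    rwa [nsmul_eq_mul] at this
  have h3 := reCLM.hasFDerivAt.comp p h2
  have hf : harm g = (⇑reCLM ∘ fun x : 𝔼 2 => toCL x ^ g) := by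
    funext x; simp [harm]
  rw [hf]
  exact h3

/-- `dP_p(v) = Re (g (toC p)^{g-1} toC v)`. [folklore] -/
@[simp] theorem harmD_apply (p v : 𝔼 2) :
    harmD g p v = ((g : ℂ) * toC p ^ (g - 1) * toC v).re := by
  simp [harmD, mul_assoc]

/-- `P` is smooth. [folklore] -/
theorem contDiff_harm : ContDiff ℝ ∞ (harm g) := by
  unfold harm
  have : ContDiff ℝ ∞ (fun p : 𝔼 2 => (toCL p) ^ g) := toCL.contDiff.pow g
  exact reCLM.contDiff.comp this

/-- **The derivative of the flower function.** [folklore] -/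
theorem hasFDerivAt_flower (p : 𝔼 2) : HasFDerivAt (flower g) (flowerD g p) p := by
  have hn : HasFDerivAt (fun p : 𝔼 2 => ‖p‖ ^ 2) (2 • (innerSL ℝ p : 𝔼 2 →L[ℝ] ℝ)) p :=
    (hasStrictFDerivAt_norm_sq p).hasFDerivAt
  have hE := (hasDerivAt_damp (g := g) (‖p‖ ^ 2)).comp_hasFDerivAt p hn
  have hP := hasFDerivAt_harm (g := g) p
  have h := hn.add ((hP.mul hE).const_mul (g : ℝ)⁻¹)
  have hfun : flower g = ((fun p : 𝔼 2 => ‖p‖ ^ 2) +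
      fun y => (g : ℝ)⁻¹ * (harm g * damp g ∘ fun p : 𝔼 2 => ‖p‖ ^ 2) y) := by
    funext y
    simp only [flower, Pi.add_apply, Pi.mul_apply, Function.comp_apply]
    ring
  rw [hfun]
  refine h.congr_fderiv ?_
  ext v
  simp [flowerD]
  ring

/-- The flower function is smooth. [folklore] -/
theorem contDiff_flower : ContDiff ℝ ∞ (flower g) := by
  unfold flower
  have h1 : ContDiff ℝ ∞ (fun p : 𝔼 2 => ‖p‖ ^ 2) := contDiff_norm_sq ℝ
  exact h1.add ((contDiff_const.mul contDiff_harm).mul (contDiff_damp.comp h1))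

/-- `fderiv q = dq`. [folklore] -/
theorem fderiv_flower : fderiv ℝ (flower g) = flowerD g :=
  funext fun p => (hasFDerivAt_flower p).fderiv

/-- `q` is differentiable. [folklore] -/
theorem differentiable_flower : Differentiable ℝ (flower g) := fun p =>
  (hasFDerivAt_flower p).differentiableAt


/-! ### §3 Evaluating `q` and `dq`: radial and angular directions, the axis -/

/-- The inner product of `ℝ²` read in `ℂ`. [folklore] -/
theorem inner_eq_re (p v : 𝔼 2) : ⟪p, v⟫_ℝ = (starRingEnd ℂ (toC p) * toC v).re := by
  rw [← toC.inner_map_map p v, Complex.inner, mul_comm]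

/-- `‖p‖² = ‖toC p‖²`. [folklore] -/
theorem norm_sq_eq (p : 𝔼 2) : ‖p‖ ^ 2 = Complex.normSq (toC p) := by
  rw [Complex.normSq_eq_norm_sq, norm_toC]

/-- The point `(r, 0)` of the axis. [folklore] -/
def ax (r : ℝ) : 𝔼 2 := toC.symm (r : ℂ)

/-- `toC (r, 0) = r`. [folklore] -/
@[simp] theorem toC_ax (r : ℝ) : toC (ax r) = r := by simp [ax]

/-- `‖(r, 0)‖ = |r|`. [folklore] -/
@[simp] theorem norm_ax (r : ℝ) : ‖ax r‖ = |r| := by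
  rw [← norm_toC, toC_ax, Complex.norm_real, Real.norm_eq_abs]

/-- `‖(r, 0)‖² = r²`. [folklore] -/
theorem norm_ax_sq (r : ℝ) : ‖ax r‖ ^ 2 = r ^ 2 := by rw [norm_ax, sq_abs]

/-- First coordinate of `(r, 0)`. [folklore] -/
@[simp] theorem ax_apply_zero (r : ℝ) : ax r 0 = r := by simp [ax]

/-- Second coordinate of `(r, 0)`. [folklore] -/
@[simp] theorem ax_apply_one (r : ℝ) : ax r 1 = 0 := by simp [ax]

/-- The vector `(0, 1)`. [folklore] -/
def e₁ : 𝔼 2 := toC.symm I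

/-- `toC (0, 1) = i`. [folklore] -/
@[simp] theorem toC_e₁ : toC e₁ = I := by simp [e₁]

/-- The quarter turn `p ↦ i p`. [folklore] -/
def perp (p : 𝔼 2) : 𝔼 2 := toC.symm (I * toC p)

/-- `toC (i p) = i · toC p`. [folklore] -/
@[simp] theorem toC_perp (p : 𝔼 2) : toC (perp p) = I * toC p := by simp [perp]

/-- `(r²)^{10g} = r^{20g}`. [folklore] -/
theorem sq_pow_ten (r : ℝ) : (r ^ 2) ^ (10 * g) = r ^ (20 * g) := by
  rw [← pow_mul]; ring_nf

/-- `P` on the axis: `P(r, 0) = r^g`. [folklore] -/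
theorem harm_ax (r : ℝ) : harm g (ax r) = r ^ g := by
  simp [harm, ← Complex.ofReal_pow]

/-- `q` on the axis. [folklore] -/
theorem flower_ax (r : ℝ) :
    flower g (ax r) = r ^ 2 + (g : ℝ)⁻¹ * r ^ g * damp g (r ^ 2) := by
  rw [flower, norm_ax_sq, harm_ax]

/-- `dq` evaluated. [folklore] -/
theorem flowerD_apply (p v : 𝔼 2) :
    flowerD g p v = 2 * (1 + (g : ℝ)⁻¹ * harm g p * dampD g (‖p‖ ^ 2)) * ⟪p, v⟫_ℝ +
      (g : ℝ)⁻¹ * damp g (‖p‖ ^ 2) * ((g : ℂ) * toC p ^ (g - 1) * toC v).re := by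
  simp only [flowerD, _root_.add_apply, FunLike.coe_smul, Pi.smul_apply,
    innerSL_apply_apply, smul_eq_mul, harmD_apply]

/-- The **radial residual**: `dq_p(p)` as a function of `s = ‖p‖²` and `P`. [folklore] -/
theorem flowerD_apply_self (hg : 1 ≤ g) (p : 𝔼 2) :
    flowerD g p p = 2 * ‖p‖ ^ 2 * (1 + (g : ℝ)⁻¹ * harm g p * dampD g (‖p‖ ^ 2)) +
      damp g (‖p‖ ^ 2) * harm g p := by
  have hg' : (g : ℝ) ≠ 0 := by exact_mod_cast (show g ≠ 0 by omega)
  have hpow : toC p ^ (g - 1) * toC p = toC p ^ g := by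
    rw [← pow_succ, Nat.sub_add_cancel hg]
  have hre : ((g : ℂ) * toC p ^ (g - 1) * toC p).re = g * harm g p := by
    rw [mul_assoc, hpow, ← Complex.ofReal_natCast, Complex.re_ofReal_mul, harm]
  rw [flowerD_apply, real_inner_self_eq_norm_sq, hre]
  field_simp

/-- The **angular residual**: `dq_p(i p) = -E(‖p‖²) · Im (toC p)^g`. [folklore] -/
theorem flowerD_apply_perp (hg : 1 ≤ g) (p : 𝔼 2) :
    flowerD g p (perp p) = -(damp g (‖p‖ ^ 2) * ((toC p) ^ g).im) := by
  have hg' : (g : ℝ) ≠ 0 := by exact_mod_cast (show g ≠ 0 by omega)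
  have hinner : ⟪p, perp p⟫_ℝ = 0 := by
    have h : (starRingEnd ℂ) (toC p) * (I * toC p) = I * (toC p * (starRingEnd ℂ) (toC p)) := by
      ring
    rw [inner_eq_re, toC_perp, h, Complex.mul_conj, Complex.I_mul_re, Complex.ofReal_im, neg_zero]
  have hpow : toC p ^ (g - 1) * (I * toC p) = I * toC p ^ g := by
    rw [mul_left_comm, ← pow_succ, Nat.sub_add_cancel hg]
  have hre : ((g : ℂ) * toC p ^ (g - 1) * (I * toC p)).re = -(g * (toC p ^ g).im) := by
    rw [mul_assoc, hpow, ← mul_assoc, mul_comm (g : ℂ) I, mul_assoc, Complex.I_mul_re,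
      ← Complex.ofReal_natCast, Complex.im_ofReal_mul]
  rw [flowerD_apply, hinner, toC_perp, hre, mul_zero, zero_add]
  field_simp


/-! ### §4 The radial profiles and the location of the critical points -/

variable (g)

/-- The derivative of the peak-ray profile `f(r) = q(r, 0) = r² + g⁻¹ r^g E(r²)`:
`f'(r) = 2r + r^{g-1} E(r²) (1 - r^{20g})`. [folklore] -/
def fd (r : ℝ) : ℝ := 2 * r + r ^ (g - 1) * damp g (r ^ 2) * (1 - r ^ (20 * g))

/-- The derivative of the valley-ray profile `r² - g⁻¹ r^g E(r²)`. [folklore] -/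
def fvd (r : ℝ) : ℝ := 2 * r - r ^ (g - 1) * damp g (r ^ 2) * (1 - r ^ (20 * g))

/-- The `g`-th roots of unity as elements of the unit circle: `ζ_j = exp(2π i j / g)`. [folklore] -/
def ζC (j : ℕ) : Circle := Circle.exp (2 * Real.pi * j / g)

variable {g}

/-- `(r²)·(r²)^{10g-1} = r^{20g}` for `g ≥ 1`. [folklore] -/
theorem sq_mul_sq_pow (hg : 1 ≤ g) (r : ℝ) : r ^ 2 * (r ^ 2) ^ (10 * g - 1) = r ^ (20 * g) := by
  rw [← pow_succ', Nat.sub_add_cancel (by omega : 1 ≤ 10 * g), sq_pow_ten]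

/-- The radial identity behind `dq` on the axis. [folklore] -/
theorem radial_identity (hg : 1 ≤ g) (r : ℝ) :
    2 * r * (1 + (g : ℝ)⁻¹ * r ^ g * dampD g (r ^ 2)) +
      (g : ℝ)⁻¹ * damp g (r ^ 2) * (g * r ^ (g - 1)) = fd g r := by
  have hg' : (g : ℝ) ≠ 0 := by exact_mod_cast (show g ≠ 0 by omega)
  have hginv : (g : ℝ)⁻¹ * g = 1 := inv_mul_cancel₀ hg'
  have h1 : r ^ g = r * r ^ (g - 1) := by
    rw [← pow_succ', Nat.sub_add_cancel hg]
  have key : r * r ^ g * (r ^ 2) ^ (10 * g - 1) = r ^ (g - 1) * r ^ (20 * g) := by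
    rw [h1, ← sq_mul_sq_pow hg r]
    ring
  rw [fd, dampD]
  linear_combination (-(r * r ^ g * (r ^ 2) ^ (10 * g - 1) * damp g (r ^ 2)) +
    damp g (r ^ 2) * r ^ (g - 1)) * hginv + (-(damp g (r ^ 2))) * key

/-- The radial residual at a point with `P = ‖p‖^g` (a peak ray) is `‖p‖ · f'(‖p‖)`. [folklore] -/
theorem residual_peak (hg : 1 ≤ g) (r : ℝ) :
    2 * r ^ 2 * (1 + (g : ℝ)⁻¹ * r ^ g * dampD g (r ^ 2)) + damp g (r ^ 2) * r ^ g =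
      r * fd g r := by
  have hg' : (g : ℝ) ≠ 0 := by exact_mod_cast (show g ≠ 0 by omega)
  have hginv : (g : ℝ)⁻¹ * g = 1 := inv_mul_cancel₀ hg'
  have h1 : r ^ g = r * r ^ (g - 1) := by
    rw [← pow_succ', Nat.sub_add_cancel hg]
  linear_combination r * radial_identity hg r + damp g (r ^ 2) * h1 +
    (-(damp g (r ^ 2) * r * r ^ (g - 1))) * hginv

/-- The radial residual at a point with `P = -‖p‖^g` (a valley ray) is `‖p‖ · fvd(‖p‖)`. [folklore] -/
theorem residual_valley (hg : 1 ≤ g) (r : ℝ) :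
    2 * r ^ 2 * (1 + (g : ℝ)⁻¹ * (-r ^ g) * dampD g (r ^ 2)) + damp g (r ^ 2) * (-r ^ g) =
      r * fvd g r := by
  have h : fvd g r = 4 * r - fd g r := by rw [fvd, fd]; ring
  rw [h, mul_sub, ← residual_peak hg r]
  ring

/-- **`dq` on the axis**: `dq_{(r,0)}(v) = f'(r) · v₀`. [folklore] -/
theorem flowerD_ax (hg : 1 ≤ g) (r : ℝ) (v : 𝔼 2) :
    flowerD g (ax r) v = fd g r * (toC v).re := by
  have hinner : ⟪ax r, v⟫_ℝ = r * (toC v).re := by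
    rw [inner_eq_re, toC_ax, Complex.conj_ofReal, Complex.re_ofReal_mul]
  have hre : ((g : ℂ) * (r : ℂ) ^ (g - 1) * toC v).re = g * r ^ (g - 1) * (toC v).re := by
    rw [← Complex.ofReal_natCast, ← Complex.ofReal_pow, ← Complex.ofReal_mul, Complex.re_ofReal_mul]
  rw [flowerD_apply, hinner, norm_ax_sq, harm_ax, toC_ax, hre, ← radial_identity hg r]
  ring

/-- The valley profile is strictly increasing: `fvd(r) > 0` for `r > 0` (`g ≥ 2`). [folklore] -/
theorem fvd_pos (hg : 2 ≤ g) {r : ℝ} (hr : 0 < r) : 0 < fvd g r := by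
  rw [fvd]
  have hd := damp_pos (g := g) (r ^ 2)
  have hd1 := damp_le_one (g := g) (sq_nonneg r)
  rcases le_or_gt r 1 with h1 | h1
  · -- `r ≤ 1`: the correction is at most `r^{g-1} ≤ r`
    have hp : r ^ (g - 1) ≤ r := by
      calc r ^ (g - 1) ≤ r ^ 1 := pow_le_pow_of_le_one hr.le h1 (by omega)
        _ = r := pow_one r
    have hu : 0 ≤ 1 - r ^ (20 * g) := sub_nonneg.2 (pow_le_one₀ hr.le h1)
    have hu1 : 1 - r ^ (20 * g) ≤ 1 := by linarith [pow_nonneg hr.le (20 * g)]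
    have : r ^ (g - 1) * damp g (r ^ 2) * (1 - r ^ (20 * g)) ≤ r := by
      calc r ^ (g - 1) * damp g (r ^ 2) * (1 - r ^ (20 * g)) ≤ r * 1 * 1 := by
            gcongr
        _ = r := by ring
    linarith
  · -- `r > 1`: the correction is negative
    have hu : 1 - r ^ (20 * g) < 0 := sub_neg.2 (one_lt_pow₀ h1 (by omega))
    have : r ^ (g - 1) * damp g (r ^ 2) * (1 - r ^ (20 * g)) < 0 :=
      mul_neg_of_pos_of_neg (mul_pos (pow_pos hr _) hd) hu
    linarith

/-- Criticality of `q` is the vanishing of `dq`. [folklore] -/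
theorem isMCriticalPt_iff (p : 𝔼 2) : IsMCriticalPt (𝓡 2) (flower g) p ↔ flowerD g p = 0 := by
  rw [MorseBirth.isMCriticalPt_iff_fderiv, fderiv_flower]

/-- At a critical point, `Im (toC p)^g = 0`. [folklore] -/
theorem im_pow_eq_zero_of_flowerD_eq_zero (hg : 1 ≤ g) {p : 𝔼 2} (hp : flowerD g p = 0) :
    ((toC p) ^ g).im = 0 := by
  have h := flowerD_apply_perp hg p
  rw [hp, _root_.zero_apply, eq_comm, neg_eq_zero, mul_eq_zero] at h
  exact h.resolve_left (damp_pos _).ne'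

/-- At a critical point, the radial residual vanishes. [folklore] -/
theorem residual_eq_zero_of_flowerD_eq_zero (hg : 1 ≤ g) {p : 𝔼 2} (hp : flowerD g p = 0) :
    2 * ‖p‖ ^ 2 * (1 + (g : ℝ)⁻¹ * harm g p * dampD g (‖p‖ ^ 2)) +
      damp g (‖p‖ ^ 2) * harm g p = 0 := by
  rw [← flowerD_apply_self hg p, hp, _root_.zero_apply]

/-- A complex number with vanishing imaginary part and norm `b` has real part `±b`. [folklore] -/
theorem re_eq_or_of_im_eq_zero {w : ℂ} (hw : w.im = 0) : w.re = ‖w‖ ∨ w.re = -‖w‖ := by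
  have h : ‖w‖ = |w.re| := by
    conv_lhs => rw [show w = (w.re : ℂ) from Complex.ext rfl (by simpa using hw)]
    rw [Complex.norm_real, Real.norm_eq_abs]
  rw [h]
  rcases le_or_gt 0 w.re with h0 | h0
  · exact Or.inl (abs_of_nonneg h0).symm
  · exact Or.inr (by rw [abs_of_neg h0, neg_neg])

/-- `P = ±‖p‖^g` at a critical point. [folklore] -/
theorem harm_eq_or_of_flowerD_eq_zero (hg : 1 ≤ g) {p : 𝔼 2} (hp : flowerD g p = 0) :
    harm g p = ‖p‖ ^ g ∨ harm g p = -‖p‖ ^ g := by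
  have h := re_eq_or_of_im_eq_zero (im_pow_eq_zero_of_flowerD_eq_zero hg hp)
  rwa [norm_pow, norm_toC] at h

/-- **No critical points on the valley rays**: at a non-zero critical point `P = +‖p‖^g`
(`g ≥ 2`). [folklore] -/
theorem harm_eq_of_flowerD_eq_zero (hg : 2 ≤ g) {p : 𝔼 2} (hp : flowerD g p = 0) (hp0 : p ≠ 0) :
    harm g p = ‖p‖ ^ g := by
  have hg1 : 1 ≤ g := by omega
  refine (harm_eq_or_of_flowerD_eq_zero hg1 hp).resolve_right fun h => ?_
  have hres := residual_eq_zero_of_flowerD_eq_zero hg1 hp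
  rw [h, residual_valley hg1 ‖p‖, mul_eq_zero] at hres
  rcases hres with h0 | h0
  · exact hp0 (norm_eq_zero.1 h0)
  · exact (fvd_pos hg (norm_pos_iff.2 hp0)).ne' h0

/-- At a non-zero critical point `f'(‖p‖) = 0` (`g ≥ 2`). [folklore] -/
theorem fd_norm_eq_zero_of_flowerD_eq_zero (hg : 2 ≤ g) {p : 𝔼 2} (hp : flowerD g p = 0)
    (hp0 : p ≠ 0) : fd g ‖p‖ = 0 := by
  have hg1 : 1 ≤ g := by omega
  have hres := residual_eq_zero_of_flowerD_eq_zero hg1 hp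
  rw [harm_eq_of_flowerD_eq_zero hg hp hp0, residual_peak hg1 ‖p‖, mul_eq_zero] at hres
  exact hres.resolve_left (norm_ne_zero_iff.2 hp0)

/-- The roots of unity `ζ_j` as complex numbers. [folklore] -/
theorem coe_ζC (j : ℕ) : (ζC g j : ℂ) = Complex.exp (2 * Real.pi * I / g) ^ j := by
  rw [ζC, Circle.coe_exp, ← Complex.exp_nat_mul]
  congr 1
  push_cast
  ring

/-- `ζ_j ^ g = 1`. [folklore] -/
theorem ζC_pow (hg : 1 ≤ g) (j : ℕ) : ((ζC g j : ℂ)) ^ g = 1 := by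
  rw [coe_ζC, ← pow_mul, mul_comm j g, pow_mul,
    (Complex.isPrimitiveRoot_exp g (by omega)).pow_eq_one, one_pow]

/-- **Location of the non-zero critical points**: on the peak rays `θ = 2πj/g`, at the zeros of
`f'`. [folklore] -/
theorem exists_eq_rot_ax_of_flowerD_eq_zero (hg : 2 ≤ g) {p : 𝔼 2} (hp : flowerD g p = 0)
    (hp0 : p ≠ 0) : ∃ j < g, p = rot (ζC g j) (ax ‖p‖) ∧ fd g ‖p‖ = 0 := by
  have hg1 : 1 ≤ g := by omega
  have hr : 0 < ‖p‖ := norm_pos_iff.2 hp0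
  have hre : ((toC p) ^ g).re = ‖p‖ ^ g := harm_eq_of_flowerD_eq_zero hg hp hp0
  have him : ((toC p) ^ g).im = 0 := im_pow_eq_zero_of_flowerD_eq_zero hg1 hp
  have hzg : (toC p) ^ g = ((‖p‖ : ℂ)) ^ g := by
    apply Complex.ext
    · rw [hre, ← Complex.ofReal_pow, Complex.ofReal_re]
    · rw [him, ← Complex.ofReal_pow, Complex.ofReal_im]
  have hr' : ((‖p‖ : ℂ)) ≠ 0 := by exact_mod_cast hr.ne'
  have hone : (toC p / ‖p‖) ^ g = 1 := by
    rw [div_pow, hzg, div_self (pow_ne_zero _ hr')]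
  haveI : NeZero g := ⟨by omega⟩
  obtain ⟨j, hj, hjeq⟩ :=
    (Complex.isPrimitiveRoot_exp g (by omega)).eq_pow_of_pow_eq_one hone
  refine ⟨j, hj, ?_, fd_norm_eq_zero_of_flowerD_eq_zero hg hp hp0⟩
  apply toC.injective
  rw [toC_rot, toC_ax, coe_ζC, hjeq, div_mul_cancel₀ _ hr']


/-! ### §5 One-variable analysis of the peak-ray profile: exactly two positive zeros of `f'` -/

variable (g)

/-- `φ(r) = r^{g-2} (r^{20g} - 1) E(r²)`, so that `f'(r) = r (2 - φ(r))`. [folklore] -/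
def φ (r : ℝ) : ℝ := r ^ (g - 2) * (r ^ (20 * g) - 1) * damp g (r ^ 2)

/-- The bracket `β(u) = (g-2)(u-1) + g u (21-u)` governing the sign of `φ'`. [folklore] -/
def β (x : ℝ) : ℝ := ((g : ℝ) - 2) * (x - 1) + g * x * (21 - x)

/-- The derivative of `φ` (as produced by the product rule). [folklore] -/
def φD (r : ℝ) : ℝ :=
  ((g - 2 : ℕ) : ℝ) * r ^ (g - 2 - 1) * (r ^ (20 * g) - 1) * damp g (r ^ 2) +
    r ^ (g - 2) * (((20 * g : ℕ) : ℝ) * r ^ (20 * g - 1)) * damp g (r ^ 2) +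
    r ^ (g - 2) * (r ^ (20 * g) - 1) * (dampD g (r ^ 2) * (2 * r))

/-- The `20g`-th root `y^{1/(20g)}`. [folklore] -/
def rt (y : ℝ) : ℝ := y ^ ((1 : ℝ) / (20 * g))

variable {g}

/-- `E(r²) = exp(-r^{20g}/20)`. [folklore] -/
theorem damp_sq (r : ℝ) : damp g (r ^ 2) = Real.exp (-(r ^ (20 * g) / 20)) := by
  rw [damp, sq_pow_ten]

/-- `f'(r) = r (2 - φ(r))` (`g ≥ 2`). [folklore] -/
theorem fd_eq (hg : 2 ≤ g) (r : ℝ) : fd g r = r * (2 - φ g r) := by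
  have h : r ^ (g - 1) = r * r ^ (g - 2) := by
    rw [← pow_succ', show g - 2 + 1 = g - 1 by omega]
  rw [fd, φ, h]
  ring

/-- The derivative of `φ`. [folklore] -/
theorem hasDerivAt_φ (r : ℝ) : HasDerivAt (φ g) (φD g r) r := by
  have hA := hasDerivAt_pow (g - 2) r
  have hB : HasDerivAt (fun x : ℝ => x ^ (20 * g) - 1) (((20 * g : ℕ) : ℝ) * r ^ (20 * g - 1)) r :=
    (hasDerivAt_pow (20 * g) r).sub_const 1
  have h2 : HasDerivAt (fun x : ℝ => x ^ 2) (2 * r) r := by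
    simpa using hasDerivAt_pow 2 r
  have hC := (hasDerivAt_damp (g := g) (r ^ 2)).comp r h2
  have h := (hA.mul hB).mul hC
  have hφ : φ g = ((fun x : ℝ => x ^ (g - 2)) * fun x : ℝ => x ^ (20 * g) - 1) *
      (damp g ∘ fun x : ℝ => x ^ 2) := by
    funext x
    simp only [φ, Pi.mul_apply, Function.comp_apply]
  rw [hφ]
  refine h.congr_deriv ?_
  simp only [φD, Pi.mul_apply, Function.comp_apply]
  ring

/-- `φ` is continuous. [folklore] -/
theorem continuous_φ : Continuous (φ g) :=
  continuous_iff_continuousAt.2 fun r => (hasDerivAt_φ r).continuousAt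

/-- **`r φ'(r) = r^{g-2} E(r²) β(r^{20g})`** (`g ≥ 2`). [folklore] -/
theorem mul_φD (hg : 2 ≤ g) (r : ℝ) :
    r * φD g r = r ^ (g - 2) * damp g (r ^ 2) * β g (r ^ (20 * g)) := by
  have hcast : ((g - 2 : ℕ) : ℝ) = (g : ℝ) - 2 := by push_cast [Nat.cast_sub hg]; ring
  have hA : ((g - 2 : ℕ) : ℝ) * (r * r ^ (g - 2 - 1)) = ((g : ℝ) - 2) * r ^ (g - 2) := by
    rcases Nat.eq_or_lt_of_le hg with h | h
    · subst h; simp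
    · rw [hcast, ← pow_succ', show g - 2 - 1 + 1 = g - 2 by omega]
  have hB : r * r ^ (20 * g - 1) = r ^ (20 * g) := by
    rw [← pow_succ', Nat.sub_add_cancel (by omega : 1 ≤ 20 * g)]
  have hC : r * (dampD g (r ^ 2) * (2 * r)) = -(g : ℝ) * r ^ (20 * g) * damp g (r ^ 2) := by
    rw [dampD, ← sq_mul_sq_pow (by omega : 1 ≤ g) r]
    ring
  have e1 : r * φD g r = ((g - 2 : ℕ) : ℝ) * (r * r ^ (g - 2 - 1)) * (r ^ (20 * g) - 1) * damp g (r ^ 2) +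
      r ^ (g - 2) * (((20 * g : ℕ) : ℝ) * (r * r ^ (20 * g - 1))) * damp g (r ^ 2) +
      r ^ (g - 2) * (r ^ (20 * g) - 1) * (r * (dampD g (r ^ 2) * (2 * r))) := by
    rw [φD]; ring
  rw [e1, hA, hB, hC, β]
  push_cast
  ring

/-- `β > 0` on `[1, 20]` (`g ≥ 2`). [folklore] -/
theorem β_pos (hg : 2 ≤ g) {x : ℝ} (h1 : 1 ≤ x) (h20 : x ≤ 20) : 0 < β g x := by
  have hg' : (2 : ℝ) ≤ g := by exact_mod_cast hg
  rw [β]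
  nlinarith [mul_nonneg (sub_nonneg.2 hg') (sub_nonneg.2 h1), mul_pos (by linarith : (0 : ℝ) < g)
    (mul_pos (by linarith : (0 : ℝ) < x) (by linarith : (0 : ℝ) < 21 - x))]

/-- `β < 0` on `[22, ∞)` (`g ≥ 2`). [folklore] -/
theorem β_neg (hg : 2 ≤ g) {x : ℝ} (h22 : 22 ≤ x) : β g x < 0 := by
  have hg' : (2 : ℝ) ≤ g := by exact_mod_cast hg
  rw [β]
  nlinarith [mul_nonneg (by linarith : (0 : ℝ) ≤ g) (mul_nonneg (by linarith : (0 : ℝ) ≤ x)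
    (by linarith : (0 : ℝ) ≤ x - 22))]

/-- `φ' > 0` where `1 ≤ r` and `r^{20g} ≤ 20` (`g ≥ 2`). [folklore] -/
theorem φD_pos (hg : 2 ≤ g) {r : ℝ} (h1 : 1 ≤ r) (h20 : r ^ (20 * g) ≤ 20) : 0 < φD g r := by
  have hr : 0 < r := by linarith
  have h := mul_φD hg r
  have hpos : 0 < r ^ (g - 2) * damp g (r ^ 2) * β g (r ^ (20 * g)) :=
    mul_pos (mul_pos (pow_pos hr _) (damp_pos _)) (β_pos hg (one_le_pow₀ h1) h20)
  rw [← h] at hpos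
  exact pos_of_mul_pos_right hpos hr.le

/-- `φ' < 0` where `r > 0` and `22 ≤ r^{20g}` (`g ≥ 2`). [folklore] -/
theorem φD_neg (hg : 2 ≤ g) {r : ℝ} (hr : 0 < r) (h22 : 22 ≤ r ^ (20 * g)) : φD g r < 0 := by
  have h := mul_φD hg r
  have hneg : r ^ (g - 2) * damp g (r ^ 2) * β g (r ^ (20 * g)) < 0 :=
    mul_neg_of_pos_of_neg (mul_pos (pow_pos hr _) (damp_pos _)) (β_neg hg h22)
  rw [← h] at hneg
  exact neg_of_mul_neg_right hneg hr.le

/-- `φ` is strictly increasing on `[1, R]` whenever `R^{20g} ≤ 20` (`g ≥ 2`). [folklore] -/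
theorem strictMonoOn_φ (hg : 2 ≤ g) {R : ℝ} (hR : R ^ (20 * g) ≤ 20) :
    StrictMonoOn (φ g) (Icc 1 R) := by
  refine strictMonoOn_of_deriv_pos (convex_Icc 1 R) continuous_φ.continuousOn fun x hx => ?_
  rw [interior_Icc] at hx
  rw [(hasDerivAt_φ x).deriv]
  refine φD_pos hg hx.1.le (le_trans ?_ hR)
  exact pow_le_pow_left₀ (by linarith [hx.1]) hx.2.le _

/-- `φ` is strictly decreasing on `[R, ∞)` whenever `R > 0` and `22 ≤ R^{20g}` (`g ≥ 2`).
[folklore] -/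
theorem strictAntiOn_φ (hg : 2 ≤ g) {R : ℝ} (hR0 : 0 < R) (hR : 22 ≤ R ^ (20 * g)) :
    StrictAntiOn (φ g) (Ici R) := by
  refine strictAntiOn_of_deriv_neg (convex_Ici R) continuous_φ.continuousOn fun x hx => ?_
  rw [interior_Ici] at hx
  rw [(hasDerivAt_φ x).deriv]
  have hx0 : 0 < x := lt_trans hR0 hx
  refine φD_neg hg hx0 (le_trans hR ?_)
  exact pow_le_pow_left₀ hR0.le (le_of_lt hx) _

/-! #### The `20g`-th roots `rt y` -/

/-- `(rt y)^{20g} = y` for `y ≥ 0` (`g ≥ 1`). [folklore] -/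
theorem rt_pow (hg : 1 ≤ g) {y : ℝ} (hy : 0 ≤ y) : (rt g y) ^ (20 * g) = y := by
  have h : ((20 * g : ℕ) : ℝ) ≠ 0 := by exact_mod_cast (show 20 * g ≠ 0 by omega)
  rw [rt, ← Real.rpow_natCast, ← Real.rpow_mul hy]
  have : (1 : ℝ) / (20 * (g : ℝ)) * ((20 * g : ℕ) : ℝ) = 1 := by
    push_cast at h ⊢
    field_simp
  rw [this, Real.rpow_one]

/-- `1 ≤ rt y` for `1 ≤ y`. [folklore] -/
theorem one_le_rt {y : ℝ} (hy : 1 ≤ y) : 1 ≤ rt g y :=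
  Real.one_le_rpow hy (by positivity)

/-- `0 < rt y` for `0 < y`. [folklore] -/
theorem rt_pos {y : ℝ} (hy : 0 < y) : 0 < rt g y := Real.rpow_pos_of_pos hy _

/-- `rt` is strictly increasing on `[0, ∞)` (`g ≥ 1`). [folklore] -/
theorem rt_lt_rt (hg : 1 ≤ g) {y y' : ℝ} (hy : 0 ≤ y) (h : y < y') : rt g y < rt g y' := by
  have hg' : (0 : ℝ) < g := by exact_mod_cast (show 0 < g by omega)
  exact Real.rpow_lt_rpow hy h (by positivity)

/-- For `r ≥ 0` and `y ≥ 0`: `r^{20g} ≤ y ↔ r ≤ rt y` (`g ≥ 1`). [folklore] -/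
theorem pow_le_iff_le_rt (hg : 1 ≤ g) {r y : ℝ} (hr : 0 ≤ r) (hy : 0 ≤ y) :
    r ^ (20 * g) ≤ y ↔ r ≤ rt g y := by
  have h0 : 20 * g ≠ 0 := by omega
  constructor
  · intro h
    by_contra hlt
    push Not at hlt
    have := pow_lt_pow_left₀ hlt (Real.rpow_nonneg hy _) h0
    rw [rt_pow hg hy] at this
    linarith
  · intro h
    calc r ^ (20 * g) ≤ (rt g y) ^ (20 * g) := pow_le_pow_left₀ hr h _
      _ = y := rt_pow hg hy

/-- For `r ≥ 0` and `y ≥ 0`: `y ≤ r^{20g} ↔ rt y ≤ r` (`g ≥ 1`). [folklore] -/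
theorem le_pow_iff_rt_le (hg : 1 ≤ g) {r y : ℝ} (hr : 0 ≤ r) (hy : 0 ≤ y) :
    y ≤ r ^ (20 * g) ↔ rt g y ≤ r := by
  have h0 : 20 * g ≠ 0 := by omega
  constructor
  · intro h
    by_contra hlt
    push Not at hlt
    have := pow_lt_pow_left₀ hlt hr h0
    rw [rt_pow hg hy] at this
    linarith
  · intro h
    calc y = (rt g y) ^ (20 * g) := (rt_pow hg hy).symm
      _ ≤ r ^ (20 * g) := pow_le_pow_left₀ (Real.rpow_nonneg hy _) h _

/-! #### Values of `φ` -/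

/-- `φ(1) = 0`. [folklore] -/
theorem φ_one : φ g 1 = 0 := by simp [φ]

/-- `φ ≤ 0` on `(0, 1]`. [folklore] -/
theorem φ_nonpos {r : ℝ} (hr : 0 ≤ r) (h1 : r ≤ 1) : φ g r ≤ 0 := by
  rw [φ]
  have hu : r ^ (20 * g) - 1 ≤ 0 := sub_nonpos.2 (pow_le_one₀ hr h1)
  exact mul_nonpos_of_nonpos_of_nonneg
    (mul_nonpos_of_nonneg_of_nonpos (pow_nonneg hr _) hu) (damp_pos _).le

/-- The numerical constant: `exp(-7/20) ≥ 13/20`. [folklore] -/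
theorem exp_neg_seven_twentieths : (13 : ℝ) / 20 ≤ Real.exp (-(7 / 20)) := by
  have := Real.add_one_le_exp (-(7 / 20 : ℝ))
  linarith

/-- **`φ(7^{1/20g}) > 2`** (`g ≥ 2`). [folklore] -/
theorem two_lt_φ_rt_seven (hg : 2 ≤ g) : 2 < φ g (rt g 7) := by
  have hg1 : 1 ≤ g := by omega
  have h7 : (rt g 7) ^ (20 * g) = 7 := rt_pow hg1 (by norm_num)
  have hA : 1 ≤ (rt g 7) ^ (g - 2) := one_le_pow₀ (one_le_rt (by norm_num))
  rw [φ, damp_sq, h7]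
  have hE := exp_neg_seven_twentieths
  nlinarith [Real.exp_pos (-(7 / 20 : ℝ))]

/-- **`φ > 2` where `20 ≤ r^{20g} ≤ 22`** (`r ≥ 1`). [folklore] -/
theorem two_lt_φ_of_mem {r : ℝ} (h1 : 1 ≤ r) (h20 : 20 ≤ r ^ (20 * g))
    (h22 : r ^ (20 * g) ≤ 22) : 2 < φ g r := by
  have hA : 1 ≤ r ^ (g - 2) := one_le_pow₀ h1
  have hE : (13 / 20 : ℝ) ^ 4 ≤ Real.exp (-(r ^ (20 * g) / 20)) := by
    calc (13 / 20 : ℝ) ^ 4 ≤ Real.exp (-(7 / 20)) ^ 4 :=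
          pow_le_pow_left₀ (by norm_num) exp_neg_seven_twentieths 4
      _ = Real.exp (4 * -(7 / 20)) := (Real.exp_nat_mul _ 4).symm
      _ ≤ Real.exp (-(r ^ (20 * g) / 20)) := Real.exp_le_exp.2 (by linarith)
  rw [φ, damp_sq]
  nlinarith [Real.exp_pos (-(r ^ (20 * g) / 20)), mul_le_mul hA (by linarith : (19 : ℝ) ≤ r ^ (20 * g) - 1)
    (by norm_num) (by linarith)]

/-- **`φ(400^{1/20g}) < 2`** (`g ≥ 2`). [folklore] -/
theorem φ_rt_four_hundred_lt_two (hg : 2 ≤ g) : φ g (rt g 400) < 2 := by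
  have hg1 : 1 ≤ g := by omega
  have h4 : (rt g 400) ^ (20 * g) = 400 := rt_pow hg1 (by norm_num)
  have h1 : 1 ≤ rt g 400 := one_le_rt (by norm_num)
  have hA : (rt g 400) ^ (g - 2) ≤ 400 := by
    calc (rt g 400) ^ (g - 2) ≤ (rt g 400) ^ (20 * g) := pow_le_pow_right₀ h1 (by omega)
      _ = 400 := h4
  have hA0 : 0 ≤ (rt g 400) ^ (g - 2) := pow_nonneg (by linarith) _
  have hexp : (79800 : ℝ) < Real.exp 20 := by
    have h1' : Real.exp 20 = Real.exp 1 ^ 20 := by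
      rw [← Real.exp_nat_mul]; norm_num
    have h2 : (2.7 : ℝ) < Real.exp 1 := lt_trans (by norm_num) Real.exp_one_gt_d9
    have h3 : (2.7 : ℝ) ^ 20 < Real.exp 1 ^ 20 := pow_lt_pow_left₀ h2 (by norm_num) (by norm_num)
    rw [h1']
    exact lt_trans (by norm_num) h3
  have hE : Real.exp (-(400 / 20 : ℝ)) * 79800 < 1 := by
    rw [show (-(400 / 20 : ℝ)) = -20 by norm_num, Real.exp_neg]
    rw [inv_mul_lt_iff₀ (Real.exp_pos 20)]
    linarith
  rw [φ, damp_sq, h4]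
  nlinarith [Real.exp_pos (-(400 / 20 : ℝ)), mul_le_mul_of_nonneg_right hA
    (mul_nonneg (by norm_num : (0:ℝ) ≤ 400 - 1) (Real.exp_pos (-(400 / 20 : ℝ))).le)]


/-! #### The two roots `r_a < r_b` of `φ = 2` -/

/-- Ordering of the marks `1 < rt 7 < rt 20 < rt 22 < rt 400`. [folklore] -/
theorem one_lt_rt_seven (hg : 1 ≤ g) : 1 < rt g 7 := by
  have := rt_lt_rt hg (le_refl (0:ℝ)) (by norm_num : (0:ℝ) < 1)
  have h1 : rt g 1 = 1 := by simp [rt]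
  have := rt_lt_rt hg (by norm_num : (0:ℝ) ≤ 1) (by norm_num : (1:ℝ) < 7)
  rwa [h1] at this

/-- There is a root of `φ = 2` in `(1, 7^{1/20g})` (intermediate value theorem). [folklore] -/
theorem exists_root_a (hg : 2 ≤ g) : ∃ r, r ∈ Ioo 1 (rt g 7) ∧ φ g r = 2 := by
  have hg1 : 1 ≤ g := by omega
  have h := intermediate_value_Ioo (one_lt_rt_seven (g := g) hg1).le continuous_φ.continuousOn
    (f := φ g)
  have hmem : (2 : ℝ) ∈ Ioo (φ g 1) (φ g (rt g 7)) := by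
    rw [φ_one]; exact ⟨by norm_num, two_lt_φ_rt_seven hg⟩
  obtain ⟨r, hr, hr2⟩ := h hmem
  exact ⟨r, hr, hr2⟩

/-- There is a root of `φ = 2` in `(22^{1/20g}, 400^{1/20g})` (intermediate value theorem). [folklore] -/
theorem exists_root_b (hg : 2 ≤ g) : ∃ r, r ∈ Ioo (rt g 22) (rt g 400) ∧ φ g r = 2 := by
  have hg1 : 1 ≤ g := by omega
  have hlt : rt g 22 < rt g 400 := rt_lt_rt hg1 (by norm_num) (by norm_num)
  have h := intermediate_value_Ioo' hlt.le continuous_φ.continuousOn (f := φ g)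
  have h22 : 2 < φ g (rt g 22) :=
    two_lt_φ_of_mem (one_le_rt (by norm_num)) (by rw [rt_pow hg1 (by norm_num)]; norm_num)
      (by rw [rt_pow hg1 (by norm_num)])
  have hmem : (2 : ℝ) ∈ Ioo (φ g (rt g 400)) (φ g (rt g 22)) :=
    ⟨φ_rt_four_hundred_lt_two hg, h22⟩
  obtain ⟨r, hr, hr2⟩ := h hmem
  exact ⟨r, hr, hr2⟩

/-- **The inner root `r_a ∈ (1, 7^{1/20g})` of `φ = 2`**: the radius of the maxima of `q`.
[folklore] -/
def ra (hg : 2 ≤ g) : ℝ := Classical.choose (exists_root_a hg)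

/-- **The outer root `r_b ∈ (22^{1/20g}, 400^{1/20g})` of `φ = 2`**: the radius of the saddles
of `q`. [folklore] -/
def rb (hg : 2 ≤ g) : ℝ := Classical.choose (exists_root_b hg)

/-- `r_a ∈ (1, 7^{1/20g})`. [folklore] -/
theorem ra_mem (hg : 2 ≤ g) : ra hg ∈ Ioo 1 (rt g 7) := (Classical.choose_spec (exists_root_a hg)).1

/-- `φ(r_a) = 2`. [folklore] -/
theorem φ_ra (hg : 2 ≤ g) : φ g (ra hg) = 2 := (Classical.choose_spec (exists_root_a hg)).2

/-- `r_b ∈ (22^{1/20g}, 400^{1/20g})`. [folklore] -/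
theorem rb_mem (hg : 2 ≤ g) : rb hg ∈ Ioo (rt g 22) (rt g 400) :=
  (Classical.choose_spec (exists_root_b hg)).1

/-- `φ(r_b) = 2`. [folklore] -/
theorem φ_rb (hg : 2 ≤ g) : φ g (rb hg) = 2 := (Classical.choose_spec (exists_root_b hg)).2

/-- `r_a > 0`. [folklore] -/
theorem ra_pos (hg : 2 ≤ g) : 0 < ra hg := lt_trans one_pos (ra_mem hg).1

/-- `r_a > 1`. [folklore] -/
theorem one_lt_ra (hg : 2 ≤ g) : 1 < ra hg := (ra_mem hg).1

/-- `r_b > 0`. [folklore] -/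
theorem rb_pos (hg : 2 ≤ g) : 0 < rb hg := lt_trans (rt_pos (by norm_num)) (rb_mem hg).1

/-- `r_a^{20g} < 7`. [folklore] -/
theorem ra_pow_lt (hg : 2 ≤ g) : (ra hg) ^ (20 * g) < 7 := by
  have hg1 : 1 ≤ g := by omega
  have h := pow_lt_pow_left₀ (ra_mem hg).2 (ra_pos hg).le (show 20 * g ≠ 0 by omega)
  rwa [rt_pow hg1 (by norm_num)] at h

/-- `22 < r_b^{20g}`. [folklore] -/
theorem lt_rb_pow (hg : 2 ≤ g) : 22 < (rb hg) ^ (20 * g) := by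
  have hg1 : 1 ≤ g := by omega
  have h := pow_lt_pow_left₀ (rb_mem hg).1 (rt_pos (by norm_num)).le (show 20 * g ≠ 0 by omega)
  rwa [rt_pow hg1 (by norm_num)] at h

/-- `r_a < 7^{1/20g} < r_b`. [folklore] -/
theorem ra_lt_rt_seven (hg : 2 ≤ g) : ra hg < rt g 7 := (ra_mem hg).2

/-- `7^{1/20g} < r_b`. [folklore] -/
theorem rt_seven_lt_rb (hg : 2 ≤ g) : rt g 7 < rb hg :=
  lt_trans (rt_lt_rt (by omega) (by norm_num) (by norm_num : (7:ℝ) < 22)) (rb_mem hg).1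

/-- `r_a < r_b`. [folklore] -/
theorem ra_lt_rb (hg : 2 ≤ g) : ra hg < rb hg := lt_trans (ra_lt_rt_seven hg) (rt_seven_lt_rb hg)

/-- **`φ > 2` strictly between the roots.** [folklore] -/
theorem two_lt_φ_of_mem_Ioo (hg : 2 ≤ g) {r : ℝ} (hr : r ∈ Ioo (ra hg) (rb hg)) : 2 < φ g r := by
  have hg1 : 1 ≤ g := by omega
  have hr1 : 1 ≤ r := le_of_lt (lt_trans (one_lt_ra hg) hr.1)
  have hr0 : 0 ≤ r := by linarith
  rcases le_or_gt (r ^ (20 * g)) 20 with h20 | h20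
  · -- increasing branch
    have hmono := strictMonoOn_φ hg (R := r) h20
    have := hmono ⟨(one_lt_ra hg).le, hr.1.le⟩ ⟨hr1, le_rfl⟩ hr.1
    rwa [φ_ra hg] at this
  rcases le_or_gt (r ^ (20 * g)) 22 with h22 | h22
  · exact two_lt_φ_of_mem hr1 h20.le h22
  · -- decreasing branch
    have hanti := strictAntiOn_φ hg (R := r) (by linarith) h22.le
    have := hanti (le_refl r) (le_of_lt hr.2) hr.2
    rwa [φ_rb hg] at this

/-- **`φ(r) = 2` for `r > 0` iff `r ∈ {r_a, r_b}`** (`g ≥ 2`). [folklore] -/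
theorem φ_eq_two_iff (hg : 2 ≤ g) {r : ℝ} (hr : 0 < r) : φ g r = 2 ↔ r = ra hg ∨ r = rb hg := by
  have hg1 : 1 ≤ g := by omega
  refine ⟨fun h => ?_, ?_⟩
  · rcases le_or_gt r 1 with h1 | h1
    · have := φ_nonpos (g := g) hr.le h1
      linarith
    rcases le_or_gt (r ^ (20 * g)) 20 with h20 | h20
    · left
      have hmono := strictMonoOn_φ hg (R := max r (ra hg)) (by
        rcases le_total r (ra hg) with h' | h'
        · rw [max_eq_right h']; linarith [ra_pow_lt hg]
        · rwa [max_eq_left h'])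
      exact hmono.injOn ⟨h1.le, le_max_left _ _⟩ ⟨(one_lt_ra hg).le, le_max_right _ _⟩
        (h.trans (φ_ra hg).symm)
    rcases le_or_gt (r ^ (20 * g)) 22 with h22 | h22
    · have := two_lt_φ_of_mem (g := g) h1.le h20.le h22
      linarith
    · right
      have hR : (22 : ℝ) ≤ (min r (rb hg)) ^ (20 * g) := by
        rcases le_total r (rb hg) with h' | h'
        · rw [min_eq_left h']; exact h22.le
        · rw [min_eq_right h']; exact (lt_rb_pow hg).le
      have hanti := strictAntiOn_φ hg (R := min r (rb hg)) (lt_min hr (rb_pos hg)) hR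
      exact hanti.injOn (Set.mem_Ici.2 (min_le_left r (rb hg)))
        (Set.mem_Ici.2 (min_le_right r (rb hg))) (h.trans (φ_rb hg).symm)
  · rintro (rfl | rfl)
    · exact φ_ra hg
    · exact φ_rb hg

/-- **The positive zeros of `f'` are exactly `r_a` and `r_b`.** [folklore] -/
theorem fd_eq_zero_iff (hg : 2 ≤ g) {r : ℝ} (hr : 0 < r) : fd g r = 0 ↔ r = ra hg ∨ r = rb hg := by
  rw [fd_eq hg, mul_eq_zero, sub_eq_zero, eq_comm (a := (2:ℝ)), φ_eq_two_iff hg hr]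
  exact or_iff_right hr.ne'

/-- `f'(r_a) = 0`. [folklore] -/
theorem fd_ra (hg : 2 ≤ g) : fd g (ra hg) = 0 := (fd_eq_zero_iff hg (ra_pos hg)).2 (Or.inl rfl)

/-- `f'(r_b) = 0`. [folklore] -/
theorem fd_rb (hg : 2 ≤ g) : fd g (rb hg) = 0 := (fd_eq_zero_iff hg (rb_pos hg)).2 (Or.inr rfl)

/-! #### Second derivative of the profile at the roots; values of the profile -/

/-- The second derivative of the peak-ray profile: `f'' = 2 - φ - r φ'`. [folklore] -/
def fdD (r : ℝ) : ℝ := 2 - φ g r - r * φD g r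

/-- `f'` has derivative `f''`. [folklore] -/
theorem hasDerivAt_fd (hg : 2 ≤ g) (r : ℝ) : HasDerivAt (fd g) (fdD (g := g) r) r := by
  have hfun : fd g = fun x => x * (2 - φ g x) := funext (fd_eq hg)
  rw [hfun]
  have h := (hasDerivAt_id r).mul ((hasDerivAt_φ (g := g) r).const_sub 2)
  refine h.congr_deriv ?_
  simp only [fdD, id]
  ring

/-- **`f''(r_a) < 0`**: the peaks are nondegenerate maxima along the ray. [folklore] -/
theorem fdD_ra_neg (hg : 2 ≤ g) : fdD (g := g) (ra hg) < 0 := by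
  have h : fdD (g := g) (ra hg) = -(ra hg * φD g (ra hg)) := by rw [fdD, φ_ra hg]; ring
  rw [h, neg_neg_iff_pos]
  exact mul_pos (ra_pos hg) (φD_pos hg (one_lt_ra hg).le (by linarith [ra_pow_lt hg]))

/-- **`f''(r_b) > 0`**: the passes are nondegenerate minima along the ray. [folklore] -/
theorem fdD_rb_pos (hg : 2 ≤ g) : 0 < fdD (g := g) (rb hg) := by
  have h : fdD (g := g) (rb hg) = -(rb hg * φD g (rb hg)) := by rw [fdD, φ_rb hg]; ring
  rw [h, neg_pos]
  exact mul_neg_of_pos_of_neg (rb_pos hg) (φD_neg hg (rb_pos hg) (lt_rb_pow hg).le)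

variable (g) in
/-- The peak-ray profile `f(r) = q(r, 0) = r² + g⁻¹ r^g E(r²)`. [folklore] -/
def prof (r : ℝ) : ℝ := r ^ 2 + (g : ℝ)⁻¹ * r ^ g * damp g (r ^ 2)

/-- `q(r, 0) = f(r)`. [folklore] -/
theorem flower_ax' (r : ℝ) : flower g (ax r) = prof g r := flower_ax r

/-- `f` has derivative `f'` (`g ≥ 1`). [folklore] -/
theorem hasDerivAt_prof (hg : 1 ≤ g) (r : ℝ) : HasDerivAt (prof g) (fd g r) r := by
  have hg' : (g : ℝ) ≠ 0 := by exact_mod_cast (show g ≠ 0 by omega)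
  have hginv : (g : ℝ)⁻¹ * g = 1 := inv_mul_cancel₀ hg'
  have h2 : HasDerivAt (fun x : ℝ => x ^ 2) (2 * r) r := by simpa using hasDerivAt_pow 2 r
  have hC := (hasDerivAt_damp (g := g) (r ^ 2)).comp r h2
  have hP := hasDerivAt_pow g r
  have h := h2.add (((hP.mul hC)).const_mul (g : ℝ)⁻¹)
  have hfun : prof g = fun x => x ^ 2 + (g : ℝ)⁻¹ * (x ^ g * (damp g ∘ fun x : ℝ => x ^ 2) x) := by
    funext x; simp only [prof, Function.comp_apply]; ring
  rw [hfun]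
  refine h.congr_deriv ?_
  simp only [Function.comp_apply]
  have h1 : r ^ g = r * r ^ (g - 1) := by rw [← pow_succ', Nat.sub_add_cancel hg]
  have key : r ^ g * r * (r ^ 2) ^ (10 * g - 1) = r ^ (g - 1) * r ^ (20 * g) := by
    rw [h1, ← sq_mul_sq_pow hg r]; ring
  rw [fd, dampD]
  linear_combination ((g - 2 : ℝ) * 0 + r ^ (g - 1) * damp g (r ^ 2) -
    r ^ g * damp g (r ^ 2) * r * (r ^ 2) ^ (10 * g - 1)) * hginv + (-(damp g (r ^ 2))) * key

/-- `f` is continuous. [folklore] -/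
theorem continuous_prof (hg : 1 ≤ g) : Continuous (prof g) :=
  continuous_iff_continuousAt.2 fun r => (hasDerivAt_prof hg r).continuousAt

/-- **`f` is strictly decreasing on `[r_a, r_b]`.** [folklore] -/
theorem strictAntiOn_prof (hg : 2 ≤ g) : StrictAntiOn (prof g) (Icc (ra hg) (rb hg)) := by
  have hg1 : 1 ≤ g := by omega
  refine strictAntiOn_of_deriv_neg (convex_Icc _ _) (continuous_prof hg1).continuousOn
    fun x hx => ?_
  rw [interior_Icc] at hx
  rw [(hasDerivAt_prof hg1 x).deriv, fd_eq hg]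
  have hx0 : 0 < x := lt_trans (ra_pos hg) hx.1
  exact mul_neg_of_pos_of_neg hx0 (by linarith [two_lt_φ_of_mem_Ioo hg hx])

variable (g) in
/-- **The level `c = f(7^{1/20g})`** separating the passes from the peaks. [folklore] -/
def level : ℝ := prof g (rt g 7)

/-- `f(r_b) < c`. [folklore] -/
theorem prof_rb_lt_level (hg : 2 ≤ g) : prof g (rb hg) < level g :=
  strictAntiOn_prof hg ⟨(ra_lt_rt_seven hg).le, (rt_seven_lt_rb hg).le⟩
    ⟨(ra_lt_rb hg).le, le_rfl⟩ (rt_seven_lt_rb hg)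

/-- `c < f(r_a)`. [folklore] -/
theorem level_lt_prof_ra (hg : 2 ≤ g) : level g < prof g (ra hg) :=
  strictAntiOn_prof hg ⟨le_rfl, (ra_lt_rb hg).le⟩
    ⟨(ra_lt_rt_seven hg).le, (rt_seven_lt_rb hg).le⟩ (ra_lt_rt_seven hg)

/-- `0 < c`. [folklore] -/
theorem level_pos (hg : 1 ≤ g) : 0 < level g := by
  rw [level, prof]
  have h7 : 0 < rt g 7 := rt_pos (by norm_num)
  have h1 : 0 < (rt g 7) ^ 2 := by positivity
  have h2 : 0 ≤ (g : ℝ)⁻¹ * (rt g 7) ^ g * damp g ((rt g 7) ^ 2) :=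
    mul_nonneg (mul_nonneg (by positivity) (pow_nonneg h7.le _)) (damp_pos _).le
  linarith


/-! ### §6 The Hessian at the axis points -/

/-- **Second derivatives along lines.** For a `C²` function `F` on `ℝ²`, the Hessian entry
`D²F_p(v, w)` is the derivative at `t = 0` of `t ↦ dF_{p + t v}(w)`. [folklore] -/
theorem hasDerivAt_fderiv_line {F : 𝔼 2 → ℝ} (hF : ContDiff ℝ 2 F) (p v w : 𝔼 2) :
    HasDerivAt (fun t : ℝ => fderiv ℝ F (p + t • v) w) (fderiv ℝ (fderiv ℝ F) p v w) 0 := by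
  have hd : DifferentiableAt ℝ (fderiv ℝ F) (p + (0 : ℝ) • v) := by
    rw [zero_smul, add_zero]
    exact (hF.fderiv_right (m := 1) (by norm_num)).differentiable (by norm_num) p
  have hG := hd.hasFDerivAt.clm_apply (hasFDerivAt_const w (p + (0 : ℝ) • v))
  have hℓ : HasDerivAt (fun t : ℝ => p + t • v) v 0 := by
    simpa using ((hasDerivAt_id (0 : ℝ)).smul_const v).const_add p
  have h := hG.comp_hasDerivAt (0 : ℝ) hℓ
  have h0 : p + (0 : ℝ) • v = p := by rw [zero_smul, add_zero]
  simp only [h0] at h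
  have key : ((fderiv ℝ F p).comp (0 : 𝔼 2 →L[ℝ] 𝔼 2) + (fderiv ℝ (fderiv ℝ F) p).flip w) v =
      fderiv ℝ (fderiv ℝ F) p v w := by
    simp
  exact h.congr_deriv key

/-- The vector `(1, 0)`. [folklore] -/
theorem toC_ax_one : toC (ax 1) = 1 := by simp

/-- Coordinates: `v = v₀ (1,0) + v₁ (0,1)` with `v₀ = Re (toC v)`, `v₁ = Im (toC v)`. [folklore] -/
theorem re_toC (v : 𝔼 2) : (toC v).re = v 0 := by simp

/-- `Im (toC v) = v₁`. [folklore] -/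
theorem im_toC (v : 𝔼 2) : (toC v).im = v 1 := by simp

/-- `v = v₀ (1, 0) + v₁ (0, 1)`. [folklore] -/
theorem eq_smul_add_smul (v : 𝔼 2) : v = v 0 • ax 1 + v 1 • e₁ := by
  apply toC.injective
  simp only [map_add, map_smul, toC_ax, toC_e₁, Complex.ofReal_one, Complex.real_smul, mul_one]
  rw [toC_apply]

/-- Moving along the axis: `(r, 0) + t (1, 0) = (r + t, 0)`. [folklore] -/
theorem ax_add_smul (r t : ℝ) : ax r + t • ax 1 = ax (r + t) := by
  apply toC.injective
  simp [Complex.ofReal_add]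

/-- Moving off the axis: `toC ((r, 0) + t (0, 1)) = r + t i`. [folklore] -/
theorem toC_ax_add_smul_e₁ (r t : ℝ) : toC (ax r + t • e₁) = r + t * I := by
  rw [map_add, map_smul, toC_ax, toC_e₁, Complex.real_smul]

/-- The Hessian entry `D²q (1,0) (1,0)` at `(r, 0)` is `f''(r)`. [folklore] -/
theorem hessian_ax_xx (hg : 2 ≤ g) (r : ℝ) :
    fderiv ℝ (fderiv ℝ (flower g)) (ax r) (ax 1) (ax 1) = fdD (g := g) r := by
  have hg1 : 1 ≤ g := by omega
  have h1 := hasDerivAt_fderiv_line ((contDiff_flower (g := g)).of_le (by norm_cast)) (ax r) (ax 1) (ax 1)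
  have h2 : HasDerivAt (fun t : ℝ => fderiv ℝ (flower g) (ax r + t • ax 1) (ax 1)) (fdD (g := g) r) 0 := by
    have hfun : (fun t : ℝ => fderiv ℝ (flower g) (ax r + t • ax 1) (ax 1)) = fun t => fd g (r + t) := by
      funext t
      rw [fderiv_flower, ax_add_smul, flowerD_ax hg1, toC_ax_one, Complex.one_re, mul_one]
    rw [hfun]
    have h := (hasDerivAt_fd hg (r + 0)).comp (0 : ℝ) ((hasDerivAt_id (0:ℝ)).const_add r)
    simpa [Function.comp_def] using h
  exact h1.unique h2

/-- The Hessian entry `D²q (1,0) (0,1)` at `(r, 0)` vanishes. [folklore] -/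
theorem hessian_ax_xy (hg : 2 ≤ g) (r : ℝ) :
    fderiv ℝ (fderiv ℝ (flower g)) (ax r) (ax 1) e₁ = 0 := by
  have hg1 : 1 ≤ g := by omega
  have h1 := hasDerivAt_fderiv_line ((contDiff_flower (g := g)).of_le (by norm_cast)) (ax r) (ax 1) e₁
  have h2 : HasDerivAt (fun t : ℝ => fderiv ℝ (flower g) (ax r + t • ax 1) e₁) 0 0 := by
    have hfun : (fun t : ℝ => fderiv ℝ (flower g) (ax r + t • ax 1) e₁) = fun _ => 0 := by
      funext t
      rw [fderiv_flower, ax_add_smul, flowerD_ax hg1, toC_e₁, Complex.I_re, mul_zero]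
    rw [hfun]
    exact hasDerivAt_const 0 0
  exact h1.unique h2


/-! #### The second column of the Hessian: derivatives across the axis -/

/-- `Re (r^n) = r^n` for real `r`. [folklore] -/
@[simp] theorem re_ofReal_pow (r : ℝ) (n : ℕ) : ((r : ℂ) ^ n).re = r ^ n := by
  rw [← Complex.ofReal_pow, Complex.ofReal_re]

/-- `Im (r^n) = 0` for real `r`. [folklore] -/
@[simp] theorem im_ofReal_pow (r : ℝ) (n : ℕ) : ((r : ℂ) ^ n).im = 0 := by
  rw [← Complex.ofReal_pow, Complex.ofReal_im]

/-- The line `t ↦ r + t i` in `ℂ` has derivative `i`. [folklore] -/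
theorem hasDerivAt_line_C (r t : ℝ) : HasDerivAt (fun t : ℝ => (r : ℂ) + t * I) I t := by
  have h := ((Complex.ofRealCLM.hasDerivAt (x := t)).mul_const I).const_add (r : ℂ)
  simpa using h

/-- Derivative of `t ↦ Re (r + t i)^m`. [folklore] -/
theorem hasDerivAt_re_pow_line (r : ℝ) (m : ℕ) (t : ℝ) :
    HasDerivAt (fun t : ℝ => (((r : ℂ) + t * I) ^ m).re)
      (((m : ℂ) * ((r : ℂ) + t * I) ^ (m - 1) * I).re) t :=
  reCLM.hasFDerivAt.comp_hasDerivAt t ((hasDerivAt_line_C r t).pow m)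

/-- Derivative of `t ↦ Re (a (r + t i)^m c)`. [folklore] -/
theorem hasDerivAt_re_const_pow_line (a c : ℂ) (r : ℝ) (m : ℕ) (t : ℝ) :
    HasDerivAt (fun t : ℝ => (a * ((r : ℂ) + t * I) ^ m * c).re)
      ((a * ((m : ℂ) * ((r : ℂ) + t * I) ^ (m - 1) * I) * c).re) t :=
  reCLM.hasFDerivAt.comp_hasDerivAt t ((((hasDerivAt_line_C r t).pow m).const_mul a).mul_const c)

/-- `dE/ds` is differentiable. [folklore] -/
theorem differentiableAt_dampD (s : ℝ) : DifferentiableAt ℝ (dampD g) s := by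
  unfold dampD damp
  fun_prop

/-- `⟨(r,0) + t(0,1), (1,0)⟩ = r`. [folklore] -/
theorem inner_line_ax_one (r t : ℝ) : ⟪ax r + t • e₁, ax 1⟫_ℝ = r := by
  rw [inner_eq_re, toC_ax_add_smul_e₁, toC_ax]
  simp [Complex.conj_ofReal]

/-- `⟨(r,0) + t(0,1), (0,1)⟩ = t`. [folklore] -/
theorem inner_line_e₁ (r t : ℝ) : ⟪ax r + t • e₁, e₁⟫_ℝ = t := by
  rw [inner_eq_re, toC_ax_add_smul_e₁, toC_e₁]
  simp [Complex.conj_ofReal]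

/-- `‖(r,0) + t(0,1)‖² = r² + t²`. [folklore] -/
theorem norm_sq_line (r t : ℝ) : ‖ax r + t • e₁‖ ^ 2 = r ^ 2 + t ^ 2 := by
  rw [norm_sq_eq, toC_ax_add_smul_e₁, Complex.normSq_add_mul_I]

/-- `P((r,0) + t(0,1)) = Re (r + t i)^g`. [folklore] -/
theorem harm_line (r t : ℝ) : harm g (ax r + t • e₁) = (((r : ℂ) + t * I) ^ g).re := by
  rw [harm, toC_ax_add_smul_e₁]

variable (g) in
/-- The Hessian entry `D²q (0,1) (0,1)` at `(r, 0)`: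
`2 + 2 g⁻¹ r^g E'(r²) - (g-1) r^{g-2} E(r²)`. [folklore] -/
def qyy (r : ℝ) : ℝ :=
  2 * (1 + (g : ℝ)⁻¹ * (r ^ g * dampD g (r ^ 2))) -
    (g : ℝ)⁻¹ * (damp g (r ^ 2) * ((g : ℝ) * ((g - 1 : ℕ) : ℝ) * r ^ (g - 1 - 1)))

/-- The Hessian entry `D²q (0,1) (1,0)` at `(r, 0)` vanishes (`g ≥ 1`). [folklore] -/
theorem hessian_ax_yx (r : ℝ) :
    fderiv ℝ (fderiv ℝ (flower g)) (ax r) e₁ (ax 1) = 0 := by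
  have h1 := hasDerivAt_fderiv_line ((contDiff_flower (g := g)).of_le (by norm_cast)) (ax r) e₁ (ax 1)
  have hA : HasDerivAt (fun t : ℝ => (((r : ℂ) + t * I) ^ g).re) 0 0 :=
    (hasDerivAt_re_pow_line r g 0).congr_deriv (by simp)
  have hS : HasDerivAt (fun t : ℝ => r ^ 2 + t ^ 2) 0 0 := by
    simpa using ((hasDerivAt_pow 2 (0:ℝ)).const_add (r ^ 2))
  have hD : HasDerivAt (fun t : ℝ => dampD g (r ^ 2 + t ^ 2)) 0 0 :=
    (((differentiableAt_dampD (g := g) _).hasDerivAt).comp 0 hS).congr_deriv (by simp)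
  have hE : HasDerivAt (fun t : ℝ => damp g (r ^ 2 + t ^ 2)) 0 0 :=
    ((hasDerivAt_damp (g := g) _).comp 0 hS).congr_deriv (by simp)
  have hB : HasDerivAt (fun t : ℝ => ((g : ℂ) * ((r : ℂ) + t * I) ^ (g - 1) * 1).re) 0 0 :=
    (hasDerivAt_re_const_pow_line (g : ℂ) 1 r (g - 1) 0).congr_deriv (by simp)
  have h := ((((((hA.mul hD).const_mul (g : ℝ)⁻¹).const_add 1).const_mul 2).mul_const r).add
    ((hE.mul hB).const_mul (g : ℝ)⁻¹))
  have hfun : (fun t : ℝ => fderiv ℝ (flower g) (ax r + t • e₁) (ax 1)) =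
      fun t : ℝ => 2 * (1 + (g : ℝ)⁻¹ * ((((r : ℂ) + t * I) ^ g).re * dampD g (r ^ 2 + t ^ 2))) * r +
        (g : ℝ)⁻¹ * (damp g (r ^ 2 + t ^ 2) * (((g : ℂ) * ((r : ℂ) + t * I) ^ (g - 1) * 1).re)) := by
    funext t
    rw [fderiv_flower, flowerD_apply, inner_line_ax_one, norm_sq_line, harm_line, toC_ax_add_smul_e₁,
      toC_ax, Complex.ofReal_one]
    ring
  rw [hfun] at h1
  have h2 : HasDerivAt (fun t : ℝ => 2 * (1 + (g : ℝ)⁻¹ * ((((r : ℂ) + t * I) ^ g).re *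
      dampD g (r ^ 2 + t ^ 2))) * r +
        (g : ℝ)⁻¹ * (damp g (r ^ 2 + t ^ 2) * (((g : ℂ) * ((r : ℂ) + t * I) ^ (g - 1) * 1).re))) 0 0 := by
    refine h.congr_deriv ?_
    ring
  exact h1.unique h2

/-- The Hessian entry `D²q (0,1) (0,1)` at `(r, 0)` (`g ≥ 1`). [folklore] -/
theorem hessian_ax_yy (r : ℝ) :
    fderiv ℝ (fderiv ℝ (flower g)) (ax r) e₁ e₁ = qyy g r := by
  have h1 := hasDerivAt_fderiv_line ((contDiff_flower (g := g)).of_le (by norm_cast)) (ax r) e₁ e₁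
  have hA : HasDerivAt (fun t : ℝ => (((r : ℂ) + t * I) ^ g).re) 0 0 :=
    (hasDerivAt_re_pow_line r g 0).congr_deriv (by simp)
  have hS : HasDerivAt (fun t : ℝ => r ^ 2 + t ^ 2) 0 0 := by
    simpa using ((hasDerivAt_pow 2 (0:ℝ)).const_add (r ^ 2))
  have hD : HasDerivAt (fun t : ℝ => dampD g (r ^ 2 + t ^ 2)) 0 0 :=
    (((differentiableAt_dampD (g := g) _).hasDerivAt).comp 0 hS).congr_deriv (by simp)
  have hE : HasDerivAt (fun t : ℝ => damp g (r ^ 2 + t ^ 2)) 0 0 :=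
    ((hasDerivAt_damp (g := g) _).comp 0 hS).congr_deriv (by simp)
  have hB : HasDerivAt (fun t : ℝ => ((g : ℂ) * ((r : ℂ) + t * I) ^ (g - 1) * I).re)
      (-((g : ℝ) * ((g - 1 : ℕ) : ℝ) * r ^ (g - 1 - 1))) 0 := by
    refine (hasDerivAt_re_const_pow_line (g : ℂ) I r (g - 1) 0).congr_deriv ?_
    simp only [Complex.ofReal_zero, zero_mul, add_zero]
    rw [← Complex.ofReal_natCast, ← Complex.ofReal_natCast]
    simp [Complex.mul_re, Complex.mul_im]
    ring
  have hT : HasDerivAt (fun t : ℝ => t) 1 0 := hasDerivAt_id 0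
  have h := (((((hA.mul hD).const_mul (g : ℝ)⁻¹).const_add 1).const_mul 2).mul hT).add
    ((hE.mul hB).const_mul (g : ℝ)⁻¹)
  have hfun : (fun t : ℝ => fderiv ℝ (flower g) (ax r + t • e₁) e₁) =
      fun t : ℝ => 2 * (1 + (g : ℝ)⁻¹ * ((((r : ℂ) + t * I) ^ g).re * dampD g (r ^ 2 + t ^ 2))) * t +
        (g : ℝ)⁻¹ * (damp g (r ^ 2 + t ^ 2) * (((g : ℂ) * ((r : ℂ) + t * I) ^ (g - 1) * I).re)) := by
    funext t
    rw [fderiv_flower, flowerD_apply, inner_line_e₁, norm_sq_line, harm_line, toC_ax_add_smul_e₁,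
      toC_e₁]
    ring
  rw [hfun] at h1
  have h2 : HasDerivAt (fun t : ℝ => 2 * (1 + (g : ℝ)⁻¹ * ((((r : ℂ) + t * I) ^ g).re *
      dampD g (r ^ 2 + t ^ 2))) * t +
        (g : ℝ)⁻¹ * (damp g (r ^ 2 + t ^ 2) * (((g : ℂ) * ((r : ℂ) + t * I) ^ (g - 1) * I).re)))
      (qyy g r) 0 := by
    refine h.congr_deriv ?_
    simp [qyy, Pi.mul_apply]
    ring
  exact h1.unique h2

/-- **`D²q (0,1)(0,1) = -g r^{g-2} E(r²)` at a zero `r > 0` of `f'`** (`g ≥ 2`). [folklore] -/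
theorem qyy_eq_of_fd_eq_zero (hg : 2 ≤ g) {r : ℝ} (hr : 0 < r) (h : fd g r = 0) :
    qyy g r = -((g : ℝ) * r ^ (g - 2) * damp g (r ^ 2)) := by
  have hg1 : 1 ≤ g := by omega
  have hg' : (g : ℝ) ≠ 0 := by exact_mod_cast (show g ≠ 0 by omega)
  have hginv : (g : ℝ)⁻¹ * g = 1 := inv_mul_cancel₀ hg'
  have hφ : φ g r = 2 := by
    have := (fd_eq_zero_iff hg hr).1 h
    exact (φ_eq_two_iff hg hr).2 this
  have hcast : ((g - 1 : ℕ) : ℝ) = (g : ℝ) - 1 := by push_cast [Nat.cast_sub hg1]; ring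
  have hpow : r ^ g * (r ^ 2) ^ (10 * g - 1) = r ^ (g - 2) * r ^ (20 * g) := by
    have : r ^ g = r ^ (g - 2) * r ^ 2 := by rw [← pow_add, Nat.sub_add_cancel hg]
    rw [this, mul_assoc, sq_mul_sq_pow hg1]
  have hsub : g - 1 - 1 = g - 2 := by omega
  rw [qyy, hcast, hsub, dampD]
  rw [φ] at hφ
  linear_combination (2 * (-(1:ℝ) / 2 * (r ^ g * (r ^ 2) ^ (10 * g - 1)) * damp g (r ^ 2)) -
    damp g (r ^ 2) * ((g : ℝ) - 1) * r ^ (g - 2)) * hginv + (-(damp g (r ^ 2))) * hpow - hφ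


/-! #### The Hessian at the axis points, its nondegeneracy and index -/

/-- **The Hessian of `q` at `(r, 0)` is diagonal: `diag(f''(r), q_yy(r))`** (`g ≥ 2`). [folklore] -/
theorem mhessian_ax (hg : 2 ≤ g) (r : ℝ) (v w : 𝔼 2) :
    mhessian (𝓡 2) (flower g) (ax r) v w = fdD (g := g) r * (v 0 * w 0) + qyy g r * (v 1 * w 1) := by
  rw [MorseBirth.mhessian_model_apply]
  conv_lhs => rw [eq_smul_add_smul v, eq_smul_add_smul w]
  simp only [map_add, map_smul, _root_.add_apply, FunLike.coe_smul, Pi.smul_apply, smul_eq_mul]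
  rw [hessian_ax_xx hg, hessian_ax_xy hg, hessian_ax_yx, hessian_ax_yy]
  ring

/-- A diagonal bilinear form on `ℝ²` with nonzero diagonal entries is nondegenerate. [folklore] -/
theorem nondegenerate_of_diag₂ {B : LinearMap.BilinForm ℝ (𝔼 2)} {a b : ℝ} (ha : a ≠ 0)
    (hb : b ≠ 0) (hB : ∀ v w, B v w = a * (v 0 * w 0) + b * (v 1 * w 1)) :
    B.Nondegenerate := by
  have key : ∀ v : 𝔼 2, (∀ w, B v w = 0) → v = 0 := by
    intro v hv
    have e0 := hv (EuclideanSpace.single 0 1)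
    have e1 := hv (EuclideanSpace.single 1 1)
    rw [hB] at e0 e1
    simp at e0 e1
    ext i
    fin_cases i
    · simpa [ha] using e0
    · simpa [hb] using e1
  have key' : ∀ w : 𝔼 2, (∀ v, B v w = 0) → w = 0 := by
    intro w hw
    refine key w fun v => ?_
    rw [hB, ← hw v, hB]
    ring
  exact ⟨fun v hv => key v hv, fun w hw => key' w hw⟩

/-- The Hessian at `(r, 0)` is equivalent to the weighted sum of squares `diag(f''(r), q_yy(r))`.
[folklore] -/
theorem equivalent_weightedSumSquares_ax (hg : 2 ≤ g) (r : ℝ) :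
    QuadraticMap.Equivalent (mhessian (𝓡 2) (flower g) (ax r)).toQuadraticMap
      (QuadraticMap.weightedSumSquares ℝ ![fdD (g := g) r, qyy g r]) := by
  refine ⟨{ toLinearEquiv := (WithLp.linearEquiv 2 ℝ (Fin 2 → ℝ)), map_app' := fun v => ?_ }⟩
  rw [QuadraticMap.weightedSumSquares_apply, LinearMap.BilinMap.toQuadraticMap_apply,
    mhessian_ax hg]
  simp [Fin.sum_univ_two, smul_eq_mul]

/-- The Morse index at `(r, 0)` is the number of negative entries of `diag(f''(r), q_yy(r))`.
[folklore] -/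
theorem morseIndex_ax (hg : 2 ≤ g) (r : ℝ) :
    morseIndex (𝓡 2) (flower g) (ax r) =
      {i : Fin 2 | (![fdD (g := g) r, qyy g r] : Fin 2 → ℝ) i < 0}.ncard := by
  unfold morseIndex
  exact QuadraticForm.sigNeg_of_equiv_weightedSumSquares (equivalent_weightedSumSquares_ax hg r)

/-- `q_yy < 0` at the positive zeros of `f'`. [folklore] -/
theorem qyy_neg_of_fd_eq_zero (hg : 2 ≤ g) {r : ℝ} (hr : 0 < r) (h : fd g r = 0) : qyy g r < 0 := by
  rw [qyy_eq_of_fd_eq_zero hg hr h, neg_neg_iff_pos]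
  have hg' : (0 : ℝ) < g := by exact_mod_cast (show 0 < g by omega)
  exact mul_pos (mul_pos hg' (pow_pos hr _)) (damp_pos _)

/-- **The Hessian at the peak `(r_a, 0)` is nondegenerate.** [folklore] -/
theorem nondegenerate_mhessian_ax_ra (hg : 2 ≤ g) :
    (mhessian (𝓡 2) (flower g) (ax (ra hg))).Nondegenerate :=
  nondegenerate_of_diag₂ (fdD_ra_neg hg).ne (qyy_neg_of_fd_eq_zero hg (ra_pos hg) (fd_ra hg)).ne
    (mhessian_ax hg (ra hg))

/-- **The Hessian at the pass `(r_b, 0)` is nondegenerate.** [folklore] -/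
theorem nondegenerate_mhessian_ax_rb (hg : 2 ≤ g) :
    (mhessian (𝓡 2) (flower g) (ax (rb hg))).Nondegenerate :=
  nondegenerate_of_diag₂ (fdD_rb_pos hg).ne' (qyy_neg_of_fd_eq_zero hg (rb_pos hg) (fd_rb hg)).ne
    (mhessian_ax hg (rb hg))

/-- **The peak `(r_a, 0)` has Morse index `2`** (a maximum). [folklore] -/
theorem morseIndex_ax_ra (hg : 2 ≤ g) : morseIndex (𝓡 2) (flower g) (ax (ra hg)) = 2 := by
  rw [morseIndex_ax hg]
  have h1 := fdD_ra_neg hg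
  have h2 := qyy_neg_of_fd_eq_zero hg (ra_pos hg) (fd_ra hg)
  have : {i : Fin 2 | (![fdD (g := g) (ra hg), qyy g (ra hg)] : Fin 2 → ℝ) i < 0} = Set.univ := by
    ext i
    fin_cases i <;> simp [h1, h2]
  rw [this, Set.ncard_univ, Nat.card_eq_fintype_card, Fintype.card_fin]

/-- **The pass `(r_b, 0)` has Morse index `1`** (a saddle). [folklore] -/
theorem morseIndex_ax_rb (hg : 2 ≤ g) : morseIndex (𝓡 2) (flower g) (ax (rb hg)) = 1 := by
  rw [morseIndex_ax hg]
  have h1 := fdD_rb_pos hg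
  have h2 := qyy_neg_of_fd_eq_zero hg (rb_pos hg) (fd_rb hg)
  have : {i : Fin 2 | (![fdD (g := g) (rb hg), qyy g (rb hg)] : Fin 2 → ℝ) i < 0} = {1} := by
    ext i
    fin_cases i
    · simp; linarith
    · simp [h2]
  rw [this, Set.ncard_singleton]

/-! #### The origin: a nondegenerate minimum -/

/-- Near the origin `q(p) ≥ ‖p‖²/2` (`g ≥ 2`). [folklore] -/
theorem half_norm_sq_le_flower (hg : 2 ≤ g) {p : 𝔼 2} (hp : ‖p‖ ≤ 1) : ‖p‖ ^ 2 / 2 ≤ flower g p := by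
  have hg' : (2 : ℝ) ≤ g := by exact_mod_cast hg
  have hginv : (g : ℝ)⁻¹ ≤ 1 / 2 := by
    rw [inv_eq_one_div]
    exact one_div_le_one_div_of_le (by norm_num) hg'
  have hginv0 : 0 ≤ (g : ℝ)⁻¹ := by positivity
  have hharm : |harm g p| ≤ ‖p‖ ^ 2 := by
    calc |harm g p| ≤ ‖(toC p) ^ g‖ := Complex.abs_re_le_norm _
      _ = ‖p‖ ^ g := by rw [norm_pow, norm_toC]
      _ ≤ ‖p‖ ^ 2 := pow_le_pow_of_le_one (norm_nonneg p) hp hg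
  have hd := damp_le_one (g := g) (sq_nonneg ‖p‖)
  have hd0 := (damp_pos (g := g) (‖p‖ ^ 2)).le
  have : |(g : ℝ)⁻¹ * harm g p * damp g (‖p‖ ^ 2)| ≤ ‖p‖ ^ 2 / 2 := by
    rw [abs_mul, abs_mul, abs_of_nonneg hginv0, abs_of_nonneg hd0]
    calc (g : ℝ)⁻¹ * |harm g p| * damp g (‖p‖ ^ 2) ≤ (1 / 2) * ‖p‖ ^ 2 * 1 := by
          gcongr
      _ = ‖p‖ ^ 2 / 2 := by ring
  rw [flower]
  have := neg_abs_le ((g : ℝ)⁻¹ * harm g p * damp g (‖p‖ ^ 2))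
  linarith

/-- `q(0) = 0` (`g ≥ 1`). [folklore] -/
theorem flower_zero (hg : 1 ≤ g) : flower g 0 = 0 := by
  have : harm g 0 = 0 := by simp [harm, zero_pow (show g ≠ 0 by omega)]
  simp [flower, this]

/-- **The origin is a local minimum of `q`** (`g ≥ 2`). [folklore] -/
theorem isLocalMin_flower_zero (hg : 2 ≤ g) : IsLocalMin (flower g) 0 := by
  have hball : Metric.closedBall (0 : 𝔼 2) 1 ∈ 𝓝 (0 : 𝔼 2) := Metric.closedBall_mem_nhds 0 one_pos
  filter_upwards [hball] with p hp
  rw [Metric.mem_closedBall, dist_zero_right] at hp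
  rw [flower_zero (by omega)]
  exact le_trans (by positivity) (half_norm_sq_le_flower hg hp)

/-- **The origin is a local minimum of `q - ‖·‖²/2`** (`g ≥ 2`). [folklore] -/
theorem isLocalMin_flower_sub_zero (hg : 2 ≤ g) :
    IsLocalMin (fun p => flower g p - ‖p‖ ^ 2 / 2) 0 := by
  have hball : Metric.closedBall (0 : 𝔼 2) 1 ∈ 𝓝 (0 : 𝔼 2) := Metric.closedBall_mem_nhds 0 one_pos
  filter_upwards [hball] with p hp
  rw [Metric.mem_closedBall, dist_zero_right] at hp
  rw [flower_zero (by omega), norm_zero]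
  have := half_norm_sq_le_flower hg hp
  simp only [ne_eq, OfNat.ofNat_ne_zero, not_false_eq_true, zero_pow, zero_div, sub_zero]
  linarith

/-- **The Hessian of `q` at the origin dominates the identity**: `D²q₀(v, v) ≥ ‖v‖²`
(`g ≥ 2`). [folklore] -/
theorem norm_sq_le_mhessian_zero (hg : 2 ≤ g) (v : 𝔼 2) :
    ‖v‖ ^ 2 ≤ mhessian (𝓡 2) (flower g) 0 v v := by
  have hq : ContDiff ℝ 2 (flower g) := (contDiff_flower (g := g)).of_le (by norm_cast)
  have hn : ContDiff ℝ 2 (fun p : 𝔼 2 => ‖p‖ ^ 2 / 2) := (contDiff_norm_sq ℝ).div_const 2 |>.of_le le_top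
  have hF : ContDiff ℝ 2 (fun p => flower g p - ‖p‖ ^ 2 / 2) := hq.sub hn
  have key := IsLocalMin.fderiv_fderiv_apply_self_nonneg hF.contDiffAt (isLocalMin_flower_sub_zero hg) v
  -- the Hessian of the difference is the difference of the Hessians
  have h1 : fderiv ℝ (fun p => flower g p - ‖p‖ ^ 2 / 2) =
      fun p => fderiv ℝ (flower g) p - fderiv ℝ (fun p : 𝔼 2 => ‖p‖ ^ 2 / 2) p := by
    funext p
    exact fderiv_sub ((hq.differentiable (by norm_num)) p) ((hn.differentiable (by norm_num)) p)
  have hdq : DifferentiableAt ℝ (fderiv ℝ (flower g)) 0 :=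
    (hq.fderiv_right (m := 1) (by norm_num)).differentiable (by norm_num) 0
  have hdn : DifferentiableAt ℝ (fderiv ℝ (fun p : 𝔼 2 => ‖p‖ ^ 2 / 2)) 0 :=
    (hn.fderiv_right (m := 1) (by norm_num)).differentiable (by norm_num) 0
  rw [h1, fderiv_fun_sub hdq hdn] at key
  have h2 : fderiv ℝ (fderiv ℝ (fun p : 𝔼 2 => ‖p‖ ^ 2 / 2)) 0 v v = ‖v‖ ^ 2 := by
    have e1 : (fun p : 𝔼 2 => ‖p‖ ^ 2 / 2) = fun p => (1 / 2 : ℝ) * ‖p‖ ^ 2 := by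
      funext p; ring
    have e2 : fderiv ℝ (fun p : 𝔼 2 => ‖p‖ ^ 2 / 2) = fun p => (innerSL ℝ p : 𝔼 2 →L[ℝ] ℝ) := by
      funext p
      rw [e1, fderiv_const_mul ((contDiff_norm_sq ℝ (n := 1)).differentiable one_ne_zero p),
        fderiv_norm_sq_apply]
      ext w
      simp
    rw [e2, ContinuousLinearMap.fderiv, innerSL_apply_apply, real_inner_self_eq_norm_sq]
  rw [MorseBirth.mhessian_model_apply]
  simp only [_root_.sub_apply] at key
  rw [h2] at key
  linarith

/-- **The Hessian of `q` at the origin is nondegenerate** (positive definite; `g ≥ 2`). [folklore] -/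
theorem nondegenerate_mhessian_zero (hg : 2 ≤ g) : (mhessian (𝓡 2) (flower g) 0).Nondegenerate := by
  have key : ∀ v : 𝔼 2, mhessian (𝓡 2) (flower g) 0 v v = 0 → v = 0 := fun v hv => by
    have h := norm_sq_le_mhessian_zero hg v
    rw [hv] at h
    have : ‖v‖ ^ 2 = 0 := le_antisymm h (sq_nonneg _)
    exact norm_eq_zero.1 (pow_eq_zero_iff two_ne_zero |>.1 this)
  exact ⟨fun v hv => key v (hv v), fun w hw => key w (hw w)⟩

/-- **The origin has Morse index `0`.** [folklore] -/
theorem morseIndex_zero (hg : 2 ≤ g) : morseIndex (𝓡 2) (flower g) 0 = 0 :=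
  IsLocalMin.morseIndex_eq_zero
    ((contMDiff_iff_contDiff.2 ((contDiff_flower (g := g)).of_le (by norm_cast))) 0)
    (isLocalMin_flower_zero hg)

/-- The origin is a critical point. [folklore] -/
theorem isMCriticalPt_zero (hg : 2 ≤ g) : IsMCriticalPt (𝓡 2) (flower g) 0 :=
  IsLocalMin.isMCriticalPt (I := 𝓡 2) (isLocalMin_flower_zero hg)


/-! ### §7 Rotational symmetry: transporting the Morse data to the other rays -/

/-- **`q` is invariant under the rotations by `g`-th roots of unity.** [folklore] -/
theorem flower_rot {a : Circle} (ha : (a : ℂ) ^ g = 1) (p : 𝔼 2) : flower g (rot a p) = flower g p := by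
  simp only [flower, norm_rot, harm, toC_rot, mul_pow, ha, one_mul]

section Transport

variable {F : 𝔼 2 → ℝ} (L : 𝔼 2 ≃L[ℝ] 𝔼 2)

/-- For `F` invariant under a linear automorphism `L`: `dF_p = dF_{Lp} ∘ L`. [folklore] -/
theorem fderiv_eq_comp_of_invariant (hF : Differentiable ℝ F) (hinv : ∀ p, F (L p) = F p)
    (p : 𝔼 2) : fderiv ℝ F p = (fderiv ℝ F (L p)).comp (L : 𝔼 2 →L[ℝ] 𝔼 2) := by
  have h : F = F ∘ L := funext fun p => (hinv p).symm
  conv_lhs => rw [h]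
  rw [fderiv_comp p (hF (L p)) L.differentiableAt, ContinuousLinearEquiv.fderiv]

/-- For `F` invariant under a linear automorphism `L`: `D²F_p(v, w) = D²F_{Lp}(Lv, Lw)`.
[folklore] -/
theorem fderiv_fderiv_eq_of_invariant (hF : ContDiff ℝ 2 F) (hinv : ∀ p, F (L p) = F p)
    (p v w : 𝔼 2) :
    fderiv ℝ (fderiv ℝ F) p v w = fderiv ℝ (fderiv ℝ F) (L p) (L v) (L w) := by
  have h : F ∘ ((L : 𝔼 2 →L[ℝ] 𝔼 2) : 𝔼 2 → 𝔼 2) = F := funext fun p => hinv p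
  have key := (L : 𝔼 2 →L[ℝ] 𝔼 2).iteratedFDeriv_comp_right hF p (i := 2) le_rfl
  rw [h] at key
  have key' := congrArg (fun M : ContinuousMultilinearMap ℝ (fun _ : Fin 2 => 𝔼 2) ℝ => M ![v, w]) key
  simp only [ContinuousMultilinearMap.compContinuousLinearMap_apply, iteratedFDeriv_two_apply] at key'
  simpa using key'

/-- Invariance of criticality. [folklore] -/
theorem isMCriticalPt_iff_of_invariant (hF : Differentiable ℝ F) (hinv : ∀ p, F (L p) = F p)
    (p : 𝔼 2) : IsMCriticalPt (𝓡 2) F (L p) ↔ IsMCriticalPt (𝓡 2) F p := by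
  rw [MorseBirth.isMCriticalPt_iff_fderiv, MorseBirth.isMCriticalPt_iff_fderiv,
    fderiv_eq_comp_of_invariant L hF hinv p]
  constructor
  · intro h; rw [h, ContinuousLinearMap.zero_comp]
  · intro h
    ext v
    have := congrArg (fun f : 𝔼 2 →L[ℝ] ℝ => f (L.symm v)) h
    simpa using this

/-- Invariance of the Hessian. [folklore] -/
theorem mhessian_eq_of_invariant (hF : ContDiff ℝ 2 F) (hinv : ∀ p, F (L p) = F p) (p v w : 𝔼 2) :
    mhessian (𝓡 2) F p v w = mhessian (𝓡 2) F (L p) (L v) (L w) := by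
  rw [MorseBirth.mhessian_model_apply, MorseBirth.mhessian_model_apply,
    fderiv_fderiv_eq_of_invariant L hF hinv]

/-- Invariance of nondegeneracy of the Hessian. [folklore] -/
theorem nondegenerate_mhessian_iff_of_invariant (hF : ContDiff ℝ 2 F) (hinv : ∀ p, F (L p) = F p)
    (p : 𝔼 2) : (mhessian (𝓡 2) F p).Nondegenerate ↔ (mhessian (𝓡 2) F (L p)).Nondegenerate :=
  nondegenerate_iff_of_forall_apply_eq L.toLinearEquiv (mhessian_eq_of_invariant L hF hinv p)

/-- Invariance of the Morse index. [folklore] -/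
theorem morseIndex_eq_of_invariant (hF : ContDiff ℝ 2 F) (hinv : ∀ p, F (L p) = F p) (p : 𝔼 2) :
    morseIndex (𝓡 2) F p = morseIndex (𝓡 2) F (L p) :=
  sigNeg_eq_of_forall_apply_eq L.toLinearEquiv (mhessian_eq_of_invariant L hF hinv p)

end Transport

/-- The rotation `rot a` as a continuous linear automorphism. [folklore] -/
def rotL (a : Circle) : 𝔼 2 ≃L[ℝ] 𝔼 2 := (rot a).toContinuousLinearEquiv

/-- `rotL a` is `rot a`. [folklore] -/
@[simp] theorem rotL_apply (a : Circle) (p : 𝔼 2) : rotL a p = rot a p := rfl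

/-- Criticality on the ray `θ = 2πj/g` reduces to the axis. [folklore] -/
theorem isMCriticalPt_rot_iff (hg : 1 ≤ g) (j : ℕ) (p : 𝔼 2) :
    IsMCriticalPt (𝓡 2) (flower g) (rot (ζC g j) p) ↔ IsMCriticalPt (𝓡 2) (flower g) p :=
  isMCriticalPt_iff_of_invariant (rotL (ζC g j)) differentiable_flower (flower_rot (ζC_pow hg j)) p

/-- Nondegeneracy on the ray `θ = 2πj/g` reduces to the axis. [folklore] -/
theorem nondegenerate_mhessian_rot_iff (hg : 1 ≤ g) (j : ℕ) (p : 𝔼 2) :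
    (mhessian (𝓡 2) (flower g) (rot (ζC g j) p)).Nondegenerate ↔
      (mhessian (𝓡 2) (flower g) p).Nondegenerate :=
  (nondegenerate_mhessian_iff_of_invariant (rotL (ζC g j))
    ((contDiff_flower (g := g)).of_le (by norm_cast)) (flower_rot (ζC_pow hg j)) p).symm

/-- The Morse index on the ray `θ = 2πj/g` reduces to the axis. [folklore] -/
theorem morseIndex_rot (hg : 1 ≤ g) (j : ℕ) (p : 𝔼 2) :
    morseIndex (𝓡 2) (flower g) (rot (ζC g j) p) = morseIndex (𝓡 2) (flower g) p :=
  (morseIndex_eq_of_invariant (rotL (ζC g j)) ((contDiff_flower (g := g)).of_le (by norm_cast))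
    (flower_rot (ζC_pow hg j)) p).symm

/-! ### §8 The flower presents a disc with `g` holes -/

/-- The axis points `(r_a, 0)`, `(r_b, 0)` are critical. [folklore] -/
theorem isMCriticalPt_ax (hg : 2 ≤ g) {r : ℝ} (hr : fd g r = 0) : IsMCriticalPt (𝓡 2) (flower g) (ax r) := by
  rw [isMCriticalPt_iff]
  ext v
  rw [flowerD_ax (by omega), hr, zero_mul, _root_.zero_apply]

/-- **The critical set of the flower**: the origin, the `g` peaks `r_a ζ_j` and the `g` passes
`r_b ζ_j`. [folklore] -/
theorem isMCriticalPt_iff_eq (hg : 2 ≤ g) (p : 𝔼 2) :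
    IsMCriticalPt (𝓡 2) (flower g) p ↔
      p = 0 ∨ ∃ j < g, p = rot (ζC g j) (ax (ra hg)) ∨ p = rot (ζC g j) (ax (rb hg)) := by
  have hg1 : 1 ≤ g := by omega
  constructor
  · intro hp
    by_cases hp0 : p = 0
    · exact Or.inl hp0
    right
    rw [isMCriticalPt_iff] at hp
    obtain ⟨j, hj, hpeq, hfd⟩ := exists_eq_rot_ax_of_flowerD_eq_zero hg hp hp0
    refine ⟨j, hj, ?_⟩
    rcases (fd_eq_zero_iff hg (norm_pos_iff.2 hp0)).1 hfd with h | h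
    · left; rwa [h] at hpeq
    · right; rwa [h] at hpeq
  · rintro (rfl | ⟨j, -, h | h⟩)
    · exact isMCriticalPt_zero hg
    · rw [h, isMCriticalPt_rot_iff hg1]
      exact isMCriticalPt_ax hg (fd_ra hg)
    · rw [h, isMCriticalPt_rot_iff hg1]
      exact isMCriticalPt_ax hg (fd_rb hg)

/-- **The flower is a Morse function** (`g ≥ 2`). [folklore] -/
theorem isMorse_flower (hg : 2 ≤ g) : IsMorse (𝓡 2) (flower g) := by
  have hg1 : 1 ≤ g := by omega
  refine ⟨contMDiff_iff_contDiff.2 contDiff_flower, fun p hp => ?_⟩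
  rcases (isMCriticalPt_iff_eq hg p).1 hp with rfl | ⟨j, -, rfl | rfl⟩
  · exact nondegenerate_mhessian_zero hg
  · exact (nondegenerate_mhessian_rot_iff hg1 j _).2 (nondegenerate_mhessian_ax_ra hg)
  · exact (nondegenerate_mhessian_rot_iff hg1 j _).2 (nondegenerate_mhessian_ax_rb hg)

/-- The Morse indices of the critical points. [folklore] -/
theorem morseIndex_rot_ax_ra (hg : 2 ≤ g) (j : ℕ) :
    morseIndex (𝓡 2) (flower g) (rot (ζC g j) (ax (ra hg))) = 2 := by
  rw [morseIndex_rot (by omega), morseIndex_ax_ra hg]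

/-- The passes `r_b ζ_j` have Morse index `1`. [folklore] -/
theorem morseIndex_rot_ax_rb (hg : 2 ≤ g) (j : ℕ) :
    morseIndex (𝓡 2) (flower g) (rot (ζC g j) (ax (rb hg))) = 1 := by
  rw [morseIndex_rot (by omega), morseIndex_ax_rb hg]

/-- The values of `q` at the critical points. [folklore] -/
theorem flower_rot_ax (hg : 1 ≤ g) (j : ℕ) (r : ℝ) : flower g (rot (ζC g j) (ax r)) = prof g r := by
  rw [flower_rot (ζC_pow hg j), flower_ax']

/-- **The critical points of index `0`: the origin only.** [folklore] -/
theorem criticalSetOfIndex_zero (hg : 2 ≤ g) : criticalSetOfIndex (𝓡 2) (flower g) 0 = {0} := by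
  ext p
  simp only [mem_criticalSetOfIndex, mem_singleton_iff]
  constructor
  · rintro ⟨hp, hi⟩
    rcases (isMCriticalPt_iff_eq hg p).1 hp with h | ⟨j, -, h | h⟩
    · exact h
    · rw [h, morseIndex_rot_ax_ra hg] at hi; omega
    · rw [h, morseIndex_rot_ax_rb hg] at hi; omega
  · rintro rfl
    exact ⟨isMCriticalPt_zero hg, morseIndex_zero hg⟩

/-- **The critical points of index `1`: the `g` passes `r_b ζ_j`.** [folklore] -/
theorem criticalSetOfIndex_one (hg : 2 ≤ g) :
    criticalSetOfIndex (𝓡 2) (flower g) 1 = (fun j : ℕ => rot (ζC g j) (ax (rb hg))) '' Iio g := by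
  ext p
  simp only [mem_criticalSetOfIndex, mem_image, mem_Iio]
  constructor
  · rintro ⟨hp, hi⟩
    rcases (isMCriticalPt_iff_eq hg p).1 hp with h | ⟨j, hj, h | h⟩
    · rw [h, morseIndex_zero hg] at hi; omega
    · rw [h, morseIndex_rot_ax_ra hg] at hi; omega
    · exact ⟨j, hj, h.symm⟩
  · rintro ⟨j, hj, rfl⟩
    exact ⟨(isMCriticalPt_iff_eq hg _).2 (Or.inr ⟨j, hj, Or.inr rfl⟩), morseIndex_rot_ax_rb hg j⟩

/-- **The critical points of index `2`: the `g` peaks `r_a ζ_j`.** [folklore] -/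
theorem criticalSetOfIndex_two (hg : 2 ≤ g) :
    criticalSetOfIndex (𝓡 2) (flower g) 2 = (fun j : ℕ => rot (ζC g j) (ax (ra hg))) '' Iio g := by
  ext p
  simp only [mem_criticalSetOfIndex, mem_image, mem_Iio]
  constructor
  · rintro ⟨hp, hi⟩
    rcases (isMCriticalPt_iff_eq hg p).1 hp with h | ⟨j, hj, h | h⟩
    · rw [h, morseIndex_zero hg] at hi; omega
    · exact ⟨j, hj, h.symm⟩
    · rw [h, morseIndex_rot_ax_rb hg] at hi; omega
  · rintro ⟨j, hj, rfl⟩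
    exact ⟨(isMCriticalPt_iff_eq hg _).2 (Or.inr ⟨j, hj, Or.inl rfl⟩), morseIndex_rot_ax_ra hg j⟩

/-- The `g` passes are distinct: `j ↦ r_b ζ_j` is injective on `j < g`. [folklore] -/
theorem injOn_rot_ax {r : ℝ} (hr : r ≠ 0) (hg : 1 ≤ g) :
    InjOn (fun j : ℕ => rot (ζC g j) (ax r)) (Iio g) := by
  intro j hj j' hj' h
  have h' := congrArg toC h
  simp only [toC_rot, toC_ax, coe_ζC] at h'
  have hr' : (r : ℂ) ≠ 0 := by exact_mod_cast hr
  have hpow := mul_right_cancel₀ hr' h'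
  exact (Complex.isPrimitiveRoot_exp g (by omega)).pow_inj hj hj' hpow

/-- **There are exactly `g` passes.** [folklore] -/
theorem ncard_criticalSetOfIndex_one (hg : 2 ≤ g) : (criticalSetOfIndex (𝓡 2) (flower g) 1).ncard = g := by
  rw [criticalSetOfIndex_one hg, (injOn_rot_ax (rb_pos hg).ne' (by omega)).ncard_image]
  rw [← Finset.coe_range, ncard_coe_finset, Finset.card_range]

/-- The critical set is finite. [folklore] -/
theorem finite_criticalSet (hg : 2 ≤ g) : (criticalSet (𝓡 2) (flower g)).Finite := by
  have hfin : ({0} ∪ ((fun j : ℕ => rot (ζC g j) (ax (ra hg))) '' Iio g ∪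
      (fun j : ℕ => rot (ζC g j) (ax (rb hg))) '' Iio g) : Set (𝔼 2)).Finite :=
    (finite_singleton _).union (((finite_Iio g).image _).union ((finite_Iio g).image _))
  refine hfin.subset fun p hp => ?_
  rw [mem_criticalSet] at hp
  rcases (isMCriticalPt_iff_eq hg p).1 hp with h | ⟨j, hj, h | h⟩
  · exact Or.inl h
  · exact Or.inr (Or.inl ⟨j, hj, h.symm⟩)
  · exact Or.inr (Or.inr ⟨j, hj, h.symm⟩)

/-- **Coercivity**: `‖p‖² ≤ q(p) + 20`. [folklore] -/
theorem norm_sq_le_flower_add (hg : 1 ≤ g) (p : 𝔼 2) : ‖p‖ ^ 2 ≤ flower g p + 20 := by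
  have hg' : (1 : ℝ) ≤ g := by exact_mod_cast hg
  have hginv : (g : ℝ)⁻¹ ≤ 1 := inv_le_one_of_one_le₀ hg'
  have hginv0 : 0 ≤ (g : ℝ)⁻¹ := by positivity
  set r := ‖p‖ with hr
  have hr0 : 0 ≤ r := norm_nonneg p
  have hharm : |harm g p| ≤ r ^ g := by
    calc |harm g p| ≤ ‖(toC p) ^ g‖ := Complex.abs_re_le_norm _
      _ = r ^ g := by rw [norm_pow, norm_toC]
  have hd0 := (damp_pos (g := g) (r ^ 2)).le
  -- the perturbation is bounded by `20`
  have hbound : r ^ g * damp g (r ^ 2) ≤ 20 := by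
    rw [damp_sq]
    rcases le_or_gt r 1 with h1 | h1
    · calc r ^ g * Real.exp (-(r ^ (20 * g) / 20)) ≤ 1 * 1 := by
            gcongr
            · exact pow_le_one₀ hr0 h1
            · rw [Real.exp_le_one_iff, neg_nonpos]; positivity
        _ ≤ 20 := by norm_num
    · have hu : r ^ g ≤ r ^ (20 * g) := pow_le_pow_right₀ h1.le (by omega)
      have hexp : r ^ (20 * g) / 20 + 1 ≤ Real.exp (r ^ (20 * g) / 20) := Real.add_one_le_exp _
      have hpos := Real.exp_pos (r ^ (20 * g) / 20)
      rw [Real.exp_neg]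
      rw [mul_inv_le_iff₀ hpos]
      nlinarith
  have : |(g : ℝ)⁻¹ * harm g p * damp g (r ^ 2)| ≤ 20 := by
    rw [abs_mul, abs_mul, abs_of_nonneg hginv0, abs_of_nonneg hd0]
    calc (g : ℝ)⁻¹ * |harm g p| * damp g (r ^ 2) ≤ 1 * r ^ g * damp g (r ^ 2) := by gcongr
      _ = r ^ g * damp g (r ^ 2) := by rw [one_mul]
      _ ≤ 20 := hbound
  rw [flower, ← hr]
  have := neg_abs_le ((g : ℝ)⁻¹ * harm g p * damp g (r ^ 2))
  linarith

/-- **The flower presents a disc with `g` holes below the level `c = f(7^{1/20g})`**: it is a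
coercive Morse function on the plane whose critical points are the origin (the minimum, value
`0 < c`), the `g` passes `r_b ζ_j` (index `1`, value `f(r_b) < c`) and the `g` peaks `r_a ζ_j`
(index `2`, value `f(r_a) > c`), for every `g ≥ 2`.  Hence (`ThickenedPlanarHandlebody.lean`)
its thickening `{q(x, y) + z² ≤ c} ⊂ ℝ³` is a genus-`g` handlebody with explicit boundary.
[folklore] -/
theorem isHoledDiscMorseFunction_flower (hg : 2 ≤ g) :
    IsHoledDiscMorseFunction g (flower g) (level g) where
  isMorse := isMorse_flower hg
  exists_bound := ⟨20, norm_sq_le_flower_add (by omega)⟩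
  finite_criticalSet := finite_criticalSet hg
  exists_index_zero := ⟨0, criticalSetOfIndex_zero hg, by
    rw [flower_zero (by omega)]; exact level_pos (by omega)⟩
  ncard_index_one := ncard_criticalSetOfIndex_one hg
  lt_of_index_one := fun u hu => by
    rw [criticalSetOfIndex_one hg] at hu
    obtain ⟨j, -, rfl⟩ := hu
    rw [flower_rot_ax (by omega)]
    exact prof_rb_lt_level hg
  lt_of_index_two := fun u hu => by
    rw [criticalSetOfIndex_two hg] at hu
    obtain ⟨j, -, rfl⟩ := hu
    rw [flower_rot_ax (by omega)]
    exact level_lt_prof_ra hg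


/-! ### §9 The flower handlebody and its boundary surface -/

open PlanarThickening

/-- **The flower handlebody** `V_g = {q_g(x, y) + z² ≤ c_g} ⊂ ℝ³` (`g ≥ 2`): the thickening of
the flower, a compact smooth `3`-manifold with boundary (`Literature.Topology.FourManifolds.RegularSublevel`).
[folklore] -/
abbrev FlowerHandlebody (hg : 2 ≤ g) : Type := (isHoledDiscMorseFunction_flower hg).Thickening

/-- **The flower handlebody is a genus-`g` handlebody** (`Literature.IsHandlebody g`: compact,
connected, orientable, one `0`-handle and `g` `1`-handles), for every `g ≥ 2` — an explicit model,
with explicit boundary, complementing the closed ball (`g = 0`) and the solid tori (`g = 1`) of the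
tree. Juhász (2023), §3.5, p. 96; Schultens (2014), Def. 6.1.5. [cite: Juhasz2023, §3.5 (p. 96)] -/
theorem isHandlebody_flowerHandlebody (hg : 2 ≤ g) : IsHandlebody g (FlowerHandlebody hg) :=
  (isHoledDiscMorseFunction_flower hg).isHandlebody_thickening

/-- A point of `V_g` is a boundary point iff it lies on the level surface `{q_g(x,y) + z² = c_g}`.
[folklore] -/
theorem mem_boundary_flowerHandlebody_iff (hg : 2 ≤ g) (z : FlowerHandlebody hg) :
    z ∈ (𝓡∂ 3).boundary (FlowerHandlebody hg) ↔
      thicken (flower g) (RegularSublevel.incl (isHoledDiscMorseFunction_flower hg).isRegularLevel z) =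
        level g :=
  RegularSublevel.mem_boundary_iff _ z

/-- The inclusion of `∂V_g` in `ℝ³`. [folklore] -/
def boundaryIncl (hg : 2 ≤ g) (z : (𝓡∂ 3).boundary (FlowerHandlebody hg)) : 𝔼 3 :=
  RegularSublevel.incl (isHoledDiscMorseFunction_flower hg).isRegularLevel z.1

/-- The inclusion `∂V_g → ℝ³` is a topological embedding. [folklore] -/
theorem isEmbedding_boundaryIncl (hg : 2 ≤ g) : Topology.IsEmbedding (boundaryIncl hg) :=
  (RegularSublevel.isEmbedding_incl _).comp Topology.IsEmbedding.subtypeVal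

/-- **The boundary of `V_g` is (embeds onto) the flower surface `{q_g(x, y) + z² = c_g}`.**
[folklore] -/
theorem range_boundaryIncl (hg : 2 ≤ g) :
    range (boundaryIncl hg) = {p : 𝔼 3 | thicken (flower g) p = level g} := by
  ext p
  constructor
  · rintro ⟨z, rfl⟩
    exact (mem_boundary_flowerHandlebody_iff hg z.1).1 z.2
  · intro hp
    have hle : thicken (flower g) p ≤ level g := le_of_eq hp
    refine ⟨⟨RegularSublevel.mk _ p hle, ?_⟩, rfl⟩
    rw [mem_boundary_flowerHandlebody_iff]
    exact hp

/-- **`∂V_g ≃ₜ {q_g(x, y) + z² = c_g}`**: the boundary of the flower handlebody is homeomorphic to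
the flower surface, the double of the disc with `g` holes `{q_g ≤ c_g}` along its boundary.
[folklore] -/
def boundaryHomeomorph (hg : 2 ≤ g) :
    ↥((𝓡∂ 3).boundary (FlowerHandlebody hg)) ≃ₜ {p : 𝔼 3 | thicken (flower g) p = level g} :=
  (isEmbedding_boundaryIncl hg).toHomeomorph.trans (Homeomorph.setCongr (range_boundaryIncl hg))

/-- The homeomorphism `∂V_g ≃ₜ {q_g + z² = c_g}` is the inclusion. [folklore] -/
@[simp] theorem boundaryHomeomorph_apply_coe (hg : 2 ≤ g) (z : (𝓡∂ 3).boundary (FlowerHandlebody hg)) :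
    (boundaryHomeomorph hg z : 𝔼 3) =
      RegularSublevel.incl (isHoledDiscMorseFunction_flower hg).isRegularLevel z.1 := rfl

/-- **Genus-`g` handlebodies with explicit boundary exist in `ℝ³` for every `g ≥ 2`** (the
existential form, in the format of `Literature.Topology.FourManifolds.exists_even_isHandlebody`).
[cite: Juhasz2023, §3.5 (pp. 96–97)] -/
theorem exists_isHandlebody_flower (hg : 2 ≤ g) :
    ∃ (F : 𝔼 3 → ℝ) (c : ℝ) (hF : IsRegularLevel (𝓡 3) F c),
      F = thicken (flower g) ∧ c = level g ∧ IsHandlebody g (RegularSublevel hF) :=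
  ⟨thicken (flower g), level g, (isHoledDiscMorseFunction_flower hg).isRegularLevel, rfl, rfl,
    isHandlebody_flowerHandlebody hg⟩

end FlowerModel

end Literature.Topology.FourManifolds
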